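import Literature.NumberTheory.LFunctions.RiemannSiegelSaddleRepresentation
import Mathlib.MeasureTheory.Integral.Gamma
import Mathlib.MeasureTheory.Measure.Lebesgue.Integral
import Mathlib.Analysis.SpecialFunctions.Gaussian.GaussianIntegral
import Mathlib.Analysis.Real.Pi.Irrational
import HarnessLib

/-!
# An explicit bound for the Riemann–Siegel remainder `R₀(t)` (Gabcke 1979, Satz 3.2.2, case `K = 0`, weakened constants)

Topic `Literature/NumberTheory/LFunctions`. Last file of the chain
`SiegelMordellIntegralTwo` → `RiemannSiegelGabckeG` → `RiemannSiegelSaddleRepresentation` → this file. The previous file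
reduced the remainder `R₀(t)` of the Riemann–Siegel formula with the single correction term `C₀ = F`
(`Literature.NumberTheory.LFunctions.Gabcke.R0`) to the integral `∫ |k(a,u) − k₀(a,u)| du` over Siegel's line
through the saddle point (`Gabcke.abs_R0_le`); `RiemannSiegelGabckeG` supplies pointwise majorants of the integrand
in the three regimes `u ∈ [0, a/2]`, `u ∈ [−a/2, 0]`, `|u| > a/2`. Here we integrate them (half-line Gaussian moments,
`1/sinh x ≤ 1/x`, and `sinh y ≥ y⁵/240` for the far part) and obtain the EXPLICIT theorem

  `|R₀(t)| ≤ (K₁ + K₂/a + K₃/a² + K₄/a³ + K₅/a⁴)/(a√a)`,  `a = √(t/2π)`,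

for `t ≥ 2` with `⌊a⌋ ≥ 1`, `a ∉ ℤ` and `cos πz ≠ 0` (the proviso of `Gabcke.satz322b_R0`), with closed-form constants
`K₁ = (2/π)(7√(3/10)/20 + 1/6) = 0.2281…` (i.e. `0.905… · t^{−3/4}`), `K₂ = 0.351…`, `K₃`, `K₄`, `K₅` as in
`Gabcke.abs_R0_le_explicit`. Gabcke's own constant for `K = 0` is `0.127 t^{−3/4}` (Satz 3.2.2 (b), via the `K = 10`
chain and the power series of `C₁ … C₁₀`), resp. `0.47 t^{−3/4}` (Satz 3.2.2 (a)); the present DIRECT `K = 0` route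
trades the constant for a short proof: no differential equation, no `C_n` for `n ≥ 1`, no tables. (A sharper
integration — `x/sinh x ≤ 1 − x²/6 + 7x⁴/360` and the exact treatment of the sign change of `4πu²/3 − ½` — gives
`0.476 t^{−3/4}` by the same pointwise majorants; not carried out here.)

* `integral_pow_mul_exp_neg_mul_sq` and the moments `I₀ … I₅`;
* `one_div_two_sinh_le_far`: `1/(2 sinh y) ≤ 120/y⁵` (`y > 0`);
* `norm_rsKer_sub_le_pos` / `norm_rsKer_sub_le_neg`: the majorants on the two half-lines as finite sums of
  `α v^k e^{−cv²}`;
* `integral_norm_rsKer_sub_le`: `∫ |k − k₀| ≤ S(a)` in closed form;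
* **`abs_R0_le_explicit`** — the theorem displayed above.

No facts, no axioms beyond the standard three.

## References

* W. Gabcke, *Neue Herleitung und explizite Restabschätzung der Riemann-Siegel-Formel*, Dissertation, Göttingen
  1979, §3.1 Satz 3.1.3 (integration of the pointwise bounds against `e^{−u²/2}/sinh`), §3.2 Satz 3.2.2 p. 55
  (`|R₀(t)| < 0.127 t^{−3/4}`, resp. `0.47 t^{−3/4}` "grob", `t ≥ 200`). [Gabcke1979]
-/

noncomputable section

open Complex Real Set MeasureTheory Filter
open Literature.NumberTheory.LFunctions.SiegelIntegral

namespace Literature.NumberTheory.LFunctions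

namespace Gabcke

/-! ## Half-line Gaussian moments -/

/-- `∫₀^∞ v^k e^{−cv²} dv = c^{−(k+1)/2} Γ((k+1)/2)/2` (`c > 0`). [folklore] -/
private lemma integral_pow_mul_exp_neg_mul_sq (k : ℕ) {c : ℝ} (hc : 0 < c) :
    ∫ v in Ioi (0:ℝ), v ^ k * Real.exp (-c * v ^ 2)
      = c ^ (-((k : ℝ) + 1) / 2) * (1 / 2) * Real.Gamma (((k : ℝ) + 1) / 2) := by
  have h := _root_.integral_rpow_mul_exp_neg_mul_rpow (p := 2) (q := k) (b := c) (by norm_num)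
    (by have := Nat.cast_nonneg (α := ℝ) k; linarith) hc
  rw [← h]
  refine setIntegral_congr_fun measurableSet_Ioi fun v _ ↦ ?_
  rw [Real.rpow_natCast, Real.rpow_two]

/-- Integrability of `v ↦ v^k e^{−cv²}` on `(0, ∞)`. [folklore] -/
private lemma integrableOn_pow_mul_exp (k : ℕ) {c : ℝ} (hc : 0 < c) :
    IntegrableOn (fun v : ℝ ↦ v ^ k * Real.exp (-c * v ^ 2)) (Ioi 0) := by
  have h := integrableOn_rpow_mul_exp_neg_mul_sq hc (s := k) (by have := Nat.cast_nonneg (α := ℝ) k; linarith)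
  refine h.congr_fun (fun v _ ↦ ?_) measurableSet_Ioi
  simp only [Real.rpow_natCast]

/-- `Γ(3/2) = √π/2`. [folklore] -/
private lemma Gamma_three_halves : Real.Gamma (3 / 2) = Real.sqrt π / 2 := by
  rw [show (3 / 2 : ℝ) = 1 / 2 + 1 by norm_num, Real.Gamma_add_one (by norm_num), Real.Gamma_one_half_eq]; ring

/-- `Γ(5/2) = 3√π/4`. [folklore] -/
private lemma Gamma_five_halves : Real.Gamma (5 / 2) = 3 * Real.sqrt π / 4 := by
  rw [show (5 / 2 : ℝ) = 3 / 2 + 1 by norm_num, Real.Gamma_add_one (by norm_num), Gamma_three_halves]; ring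

/-- `c^{−3/2} = (c √c)⁻¹` for `c > 0`. [folklore] -/
private lemma rpow_neg_three_halves {c : ℝ} (hc : 0 < c) : c ^ (-(3 / 2 : ℝ)) = (c * Real.sqrt c)⁻¹ := by
  rw [show (3 / 2 : ℝ) = 1 + 1 / 2 by norm_num, Real.rpow_neg hc.le, Real.rpow_add hc, Real.rpow_one,
    ← Real.sqrt_eq_rpow]

/-- `c^{−5/2} = (c² √c)⁻¹` for `c > 0`. [folklore] -/
private lemma rpow_neg_five_halves {c : ℝ} (hc : 0 < c) : c ^ (-(5 / 2 : ℝ)) = (c ^ 2 * Real.sqrt c)⁻¹ := by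
  rw [show (5 / 2 : ℝ) = 2 + 1 / 2 by norm_num, Real.rpow_neg hc.le, Real.rpow_add hc, Real.rpow_two,
    ← Real.sqrt_eq_rpow]

/-- `I₀(c) = √(π/c)/2`. [folklore] -/
private lemma moment_zero (c : ℝ) :
    ∫ v in Ioi (0:ℝ), v ^ 0 * Real.exp (-c * v ^ 2) = Real.sqrt (π / c) / 2 := by
  simp only [pow_zero, one_mul]
  exact integral_gaussian_Ioi c

/-- `I₁(c) = 1/(2c)`. [folklore] -/
private lemma moment_one {c : ℝ} (hc : 0 < c) :
    ∫ v in Ioi (0:ℝ), v ^ 1 * Real.exp (-c * v ^ 2) = 1 / (2 * c) := by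
  rw [integral_pow_mul_exp_neg_mul_sq 1 hc, show -(((1:ℕ):ℝ) + 1) / 2 = -1 by norm_num,
    show (((1:ℕ):ℝ) + 1) / 2 = 1 by norm_num, Real.rpow_neg_one, Real.Gamma_one]
  field_simp

/-- `I₂(c) = √(π/c)/(4c)`. [folklore] -/
private lemma moment_two {c : ℝ} (hc : 0 < c) :
    ∫ v in Ioi (0:ℝ), v ^ 2 * Real.exp (-c * v ^ 2) = Real.sqrt (π / c) / (4 * c) := by
  rw [integral_pow_mul_exp_neg_mul_sq 2 hc, show -(((2:ℕ):ℝ) + 1) / 2 = -(3 / 2 : ℝ) by norm_num,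
    show (((2:ℕ):ℝ) + 1) / 2 = 3 / 2 by norm_num, rpow_neg_three_halves hc, Gamma_three_halves,
    Real.sqrt_div' _ hc.le]
  have : Real.sqrt c ≠ 0 := (Real.sqrt_pos.2 hc).ne'
  field_simp
  norm_num

/-- `I₃(c) = 1/(2c²)`. [folklore] -/
private lemma moment_three {c : ℝ} (hc : 0 < c) :
    ∫ v in Ioi (0:ℝ), v ^ 3 * Real.exp (-c * v ^ 2) = 1 / (2 * c ^ 2) := by
  rw [integral_pow_mul_exp_neg_mul_sq 3 hc, show -(((3:ℕ):ℝ) + 1) / 2 = -(2 : ℝ) by norm_num,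
    show (((3:ℕ):ℝ) + 1) / 2 = 2 by norm_num, Real.rpow_neg hc.le, Real.rpow_two, Real.Gamma_two]
  field_simp

/-- `I₄(c) = 3√(π/c)/(8c²)`. [folklore] -/
private lemma moment_four {c : ℝ} (hc : 0 < c) :
    ∫ v in Ioi (0:ℝ), v ^ 4 * Real.exp (-c * v ^ 2) = 3 * Real.sqrt (π / c) / (8 * c ^ 2) := by
  rw [integral_pow_mul_exp_neg_mul_sq 4 hc, show -(((4:ℕ):ℝ) + 1) / 2 = -(5 / 2 : ℝ) by norm_num,
    show (((4:ℕ):ℝ) + 1) / 2 = 5 / 2 by norm_num, rpow_neg_five_halves hc, Gamma_five_halves,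
    Real.sqrt_div' _ hc.le]
  have : Real.sqrt c ≠ 0 := (Real.sqrt_pos.2 hc).ne'
  field_simp
  norm_num

/-- `I₅(c) = 1/c³`. [folklore] -/
private lemma moment_five {c : ℝ} (hc : 0 < c) :
    ∫ v in Ioi (0:ℝ), v ^ 5 * Real.exp (-c * v ^ 2) = 1 / c ^ 3 := by
  rw [integral_pow_mul_exp_neg_mul_sq 5 hc, show -(((5:ℕ):ℝ) + 1) / 2 = -((3:ℕ) : ℝ) by norm_num,
    show (((5:ℕ):ℝ) + 1) / 2 = 2 + 1 by norm_num, Real.rpow_neg hc.le, Real.rpow_natCast,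
    Real.Gamma_add_one (by norm_num), Real.Gamma_two]
  field_simp

/-! ## The hyperbolic sine -/

/-- `1/(2 sinh y) ≤ 120/y⁵` for `y > 0` (`sinh y ≥ (e^y − 1)/2 ≥ y⁵/240`). [folklore] -/
private lemma one_div_two_sinh_le_far {y : ℝ} (hy : 0 < y) : 1 / (2 * Real.sinh y) ≤ 120 / y ^ 5 := by
  have hsum := Real.sum_le_exp_of_nonneg hy.le 6
  simp only [Finset.sum_range_succ, Finset.sum_range_zero, Nat.factorial, pow_zero, pow_one, Nat.cast_one,
    zero_add] at hsum
  norm_num at hsum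
  have hexp : Real.exp (-y) ≤ 1 := by rw [Real.exp_le_one_iff]; linarith
  have hsinh : y ^ 5 / 240 ≤ Real.sinh y := by
    rw [Real.sinh_eq]
    nlinarith [pow_pos hy 2, pow_pos hy 3, pow_pos hy 4]
  have h5 : 0 < y ^ 5 := pow_pos hy 5
  rw [div_le_div_iff₀ (by nlinarith) h5]
  nlinarith

/-- `sinh` comparison for the far region: `1/(2 sinh(πv)) ≤ 1/(2 sinh(πa/2))` for `v ≥ a/2 > 0`. [folklore] -/
private lemma one_div_sinh_mono {a v : ℝ} (ha : 0 < a) (hv : a / 2 ≤ v) :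
    1 / (2 * Real.sinh (π * v)) ≤ 1 / (2 * Real.sinh (π * a / 2)) := by
  have h1 : 0 < Real.sinh (π * a / 2) := Real.sinh_pos_iff.2 (by positivity)
  have h2 : Real.sinh (π * a / 2) ≤ Real.sinh (π * v) := Real.sinh_le_sinh.2 (by nlinarith [Real.pi_pos])
  exact one_div_le_one_div_of_le (by positivity) (by linarith)

/-! ## Integrals of `(polynomial of degree ≤ 5) × e^{−cv²}` over `(0, ∞)` -/

/-- The integral of `(b₀ + b₁v + … + b₅v⁵) e^{−cv²}` over `(0,∞)` in closed form. [folklore] -/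
private lemma integral_poly_mul_exp (b₀ b₁ b₂ b₃ b₄ b₅ : ℝ) {c : ℝ} (hc : 0 < c) :
    ∫ v in Ioi (0:ℝ), (b₀ + b₁ * v + b₂ * v ^ 2 + b₃ * v ^ 3 + b₄ * v ^ 4 + b₅ * v ^ 5) * Real.exp (-c * v ^ 2)
      = b₀ * (Real.sqrt (π / c) / 2) + b₁ * (1 / (2 * c)) + b₂ * (Real.sqrt (π / c) / (4 * c))
        + b₃ * (1 / (2 * c ^ 2)) + b₄ * (3 * Real.sqrt (π / c) / (8 * c ^ 2)) + b₅ * (1 / c ^ 3) := by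
  have hI : ∀ k : ℕ, ∀ b : ℝ, IntegrableOn (fun v : ℝ ↦ b * (v ^ k * Real.exp (-c * v ^ 2))) (Ioi 0) :=
    fun k b ↦ (integrableOn_pow_mul_exp k hc).const_mul b
  set t : ℕ → ℝ → ℝ := fun k v ↦ v ^ k * Real.exp (-c * v ^ 2) with ht
  have hsplit : (fun v : ℝ ↦ (b₀ + b₁ * v + b₂ * v ^ 2 + b₃ * v ^ 3 + b₄ * v ^ 4 + b₅ * v ^ 5) * Real.exp (-c * v ^ 2))
      = fun v : ℝ ↦ b₀ * t 0 v + b₁ * t 1 v + b₂ * t 2 v + b₃ * t 3 v + b₄ * t 4 v + b₅ * t 5 v := by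
    funext v; simp only [ht]; ring
  rw [hsplit,
    integral_add (f := fun v ↦ b₀ * t 0 v + b₁ * t 1 v + b₂ * t 2 v + b₃ * t 3 v + b₄ * t 4 v) (g := fun v ↦ b₅ * t 5 v)
      (((((hI 0 b₀).add (hI 1 b₁)).add (hI 2 b₂)).add (hI 3 b₃)).add (hI 4 b₄)) (hI 5 b₅),
    integral_add (f := fun v ↦ b₀ * t 0 v + b₁ * t 1 v + b₂ * t 2 v + b₃ * t 3 v) (g := fun v ↦ b₄ * t 4 v)
      ((((hI 0 b₀).add (hI 1 b₁)).add (hI 2 b₂)).add (hI 3 b₃)) (hI 4 b₄),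
    integral_add (f := fun v ↦ b₀ * t 0 v + b₁ * t 1 v + b₂ * t 2 v) (g := fun v ↦ b₃ * t 3 v)
      (((hI 0 b₀).add (hI 1 b₁)).add (hI 2 b₂)) (hI 3 b₃),
    integral_add (f := fun v ↦ b₀ * t 0 v + b₁ * t 1 v) (g := fun v ↦ b₂ * t 2 v) ((hI 0 b₀).add (hI 1 b₁)) (hI 2 b₂),
    integral_add (f := fun v ↦ b₀ * t 0 v) (g := fun v ↦ b₁ * t 1 v) (hI 0 b₀) (hI 1 b₁)]
  simp only [ht, integral_const_mul, moment_zero, moment_one hc, moment_two hc, moment_three hc, moment_four hc,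
    moment_five hc]

/-- Integrability of `(b₀ + … + b₅v⁵) e^{−cv²}` on `(0, ∞)`. [folklore] -/
private lemma integrableOn_poly_mul_exp (b₀ b₁ b₂ b₃ b₄ b₅ : ℝ) {c : ℝ} (hc : 0 < c) :
    IntegrableOn (fun v : ℝ ↦ (b₀ + b₁ * v + b₂ * v ^ 2 + b₃ * v ^ 3 + b₄ * v ^ 4 + b₅ * v ^ 5)
      * Real.exp (-c * v ^ 2)) (Ioi 0) := by
  have hI : ∀ k : ℕ, ∀ b : ℝ, IntegrableOn (fun v : ℝ ↦ b * (v ^ k * Real.exp (-c * v ^ 2))) (Ioi 0) :=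
    fun k b ↦ (integrableOn_pow_mul_exp k hc).const_mul b
  have h : IntegrableOn (fun v : ℝ ↦ b₀ * (v ^ 0 * Real.exp (-c * v ^ 2)) + b₁ * (v ^ 1 * Real.exp (-c * v ^ 2))
      + b₂ * (v ^ 2 * Real.exp (-c * v ^ 2)) + b₃ * (v ^ 3 * Real.exp (-c * v ^ 2))
      + b₄ * (v ^ 4 * Real.exp (-c * v ^ 2)) + b₅ * (v ^ 5 * Real.exp (-c * v ^ 2))) (Ioi 0) :=
    (((((hI 0 b₀).add (hI 1 b₁)).add (hI 2 b₂)).add (hI 3 b₃)).add (hI 4 b₄)).add (hI 5 b₅)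
  refine h.congr_fun (fun v _ ↦ ?_) measurableSet_Ioi
  simp only; ring

/-! ## The majorants on the two half-lines -/

/-- The polynomial `P₊(a, v)` with `B(a, v) ≤ v · P₊(a, v)` for `v ≥ 0` (`B = Gabcke.gBound`):
`P₊ = √2/(2a) + v/(2a²) + (4√2π/(3a) + (2+√2)√2/(3a³)) v² + (2π/a²) v³ + ((2+√2)√2(8π/5)/a³) v⁴`.
[cite: Gabcke1979, §3.1 Satz 3.1.3] -/
def polyPos (a v : ℝ) : ℝ :=
  Real.sqrt 2 / (2 * a) + 1 / (2 * a ^ 2) * v + (4 * Real.sqrt 2 * π / (3 * a) + (2 + Real.sqrt 2) * Real.sqrt 2 / (3 * a ^ 3)) * v ^ 2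
    + 2 * π / a ^ 2 * v ^ 3 + (2 + Real.sqrt 2) * Real.sqrt 2 * (8 * π / 5) / a ^ 3 * v ^ 4 + 0 * v ^ 5

/-- The polynomial `P₋(a, v) = P₊(a, v)(1 + v/a)`, expanded. [cite: Gabcke1979, §3.1 Satz 3.1.3] -/
def polyNeg (a v : ℝ) : ℝ :=
  Real.sqrt 2 / (2 * a) + (1 / (2 * a ^ 2) + Real.sqrt 2 / (2 * a ^ 2)) * v
    + (4 * Real.sqrt 2 * π / (3 * a) + (2 + Real.sqrt 2) * Real.sqrt 2 / (3 * a ^ 3) + 1 / (2 * a ^ 3)) * v ^ 2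
    + (2 * π / a ^ 2 + (4 * Real.sqrt 2 * π / (3 * a ^ 2) + (2 + Real.sqrt 2) * Real.sqrt 2 / (3 * a ^ 4))) * v ^ 3
    + ((2 + Real.sqrt 2) * Real.sqrt 2 * (8 * π / 5) / a ^ 3 + 2 * π / a ^ 3) * v ^ 4
    + (2 + Real.sqrt 2) * Real.sqrt 2 * (8 * π / 5) / a ^ 4 * v ^ 5

/-- `B(a, v) ≤ v · P₊(a, v)` for `v ≥ 0` (triangle inequality on `|4πv³/3 − v/2|`). [cite: Gabcke1979, §3.1 Satz 3.1.3] -/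
private lemma gBound_le_mul_polyPos {a v : ℝ} (ha : 0 < a) (hv : 0 ≤ v) : gBound a v ≤ v * polyPos a v := by
  have habs : |4 * π * v ^ 3 / 3 - v / 2| ≤ 4 * π * v ^ 3 / 3 + v / 2 := by
    refine abs_le.2 ⟨?_, ?_⟩ <;> nlinarith [pow_nonneg hv 3, Real.pi_pos]
  have hv3 : |v| ^ 3 = v ^ 3 := by rw [abs_of_nonneg hv]
  have hv5 : |v| ^ 5 = v ^ 5 := by rw [abs_of_nonneg hv]
  rw [gBound, hv3, hv5, polyPos]
  have h1 : Real.sqrt 2 / a * |4 * π * v ^ 3 / 3 - v / 2| ≤ Real.sqrt 2 / a * (4 * π * v ^ 3 / 3 + v / 2) :=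
    mul_le_mul_of_nonneg_left habs (by positivity)
  have e : v * (Real.sqrt 2 / (2 * a) + 1 / (2 * a ^ 2) * v
      + (4 * Real.sqrt 2 * π / (3 * a) + (2 + Real.sqrt 2) * Real.sqrt 2 / (3 * a ^ 3)) * v ^ 2
      + 2 * π / a ^ 2 * v ^ 3 + (2 + Real.sqrt 2) * Real.sqrt 2 * (8 * π / 5) / a ^ 3 * v ^ 4 + 0 * v ^ 5)
      = Real.sqrt 2 / a * (4 * π * v ^ 3 / 3 + v / 2) + (v ^ 2 / 2 + 2 * π * v ^ 4) / a ^ 2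
        + (2 + Real.sqrt 2) * (Real.sqrt 2 / a ^ 3 * (8 * π * v ^ 5 / 5 + v ^ 3 / 3)) := by
    field_simp; ring
  rw [e]; linarith

/-- `P₋ = P₊ (1 + v/a)`. [cite: Gabcke1979, §3.1 Satz 3.1.3] -/
private lemma polyNeg_eq {a : ℝ} (ha : a ≠ 0) (v : ℝ) : polyNeg a v = polyPos a v * (1 + v / a) := by
  rw [polyNeg, polyPos]; field_simp; ring

/-- `gBound` is even in `u`. [cite: Gabcke1979, §3.1 Satz 3.1.2] -/
private lemma gBound_neg (a v : ℝ) : gBound a (-v) = gBound a v := by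
  simp only [gBound, abs_neg, even_two.neg_pow, show (-v) ^ 4 = v ^ 4 by ring,
    show 4 * π * (-v) ^ 3 / 3 - -v / 2 = -(4 * π * v ^ 3 / 3 - v / 2) by ring]

/-- The far factor `F(a) = 1/(2 sinh(πa/2))`. [cite: Gabcke1979, §3.1 Satz 3.1.3] -/
def farFactor (a : ℝ) : ℝ := 1 / (2 * Real.sinh (π * a / 2))

/-- `F(a) ≥ 0` for `a > 0`. [cite: Gabcke1979, §3.1 Satz 3.1.3] -/
private lemma farFactor_nonneg {a : ℝ} (ha : 0 < a) : 0 ≤ farFactor a := by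
  have := Real.sinh_pos_iff.2 (show 0 < π * a / 2 by positivity)
  unfold farFactor; positivity

/-- `F(a) ≤ 3840/(π⁵ a⁵)`. [cite: Gabcke1979, §3.1 Satz 3.1.3] -/
private lemma farFactor_le {a : ℝ} (ha : 0 < a) : farFactor a ≤ 3840 / (π ^ 5 * a ^ 5) := by
  have h := one_div_two_sinh_le_far (show 0 < π * a / 2 by positivity)
  rw [farFactor]
  refine h.trans (le_of_eq ?_)
  field_simp
  ring

/-- **Majorant on the positive half-line**: for `a > 0` and `v > 0`,
`|k(a,v) − k₀(a,v)| ≤ P₊(a,v) e^{−(10π/3)v²}/(2π) + F(a)(e^{(log 2)/4} e^{−πv²} + e^{−4πv²})`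
(core regime `v ≤ a/2` with `1/sinh(πv) ≤ 1/(πv)`; far regime `v > a/2`). [cite: Gabcke1979, §3.1 Satz 3.1.3] -/
theorem norm_rsKer_sub_le_pos {a v : ℝ} (ha : 0 < a) (hv : 0 < v) :
    ‖rsKer a v - rsKer0 a v‖ ≤ polyPos a v / (2 * π) * Real.exp (-(10 * π / 3) * v ^ 2)
      + farFactor a * (Real.exp (Real.log 2 / 4) * Real.exp (-π * v ^ 2) + Real.exp (-4 * π * v ^ 2)) := by
  have h0 := norm_rsKer_sub_rsKer0_le a hv.ne'
  rw [abs_of_pos hv] at h0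
  have hsinh : 0 < Real.sinh (π * v) := Real.sinh_pos_iff.2 (by positivity)
  have hcore_nn : 0 ≤ polyPos a v / (2 * π) * Real.exp (-(10 * π / 3) * v ^ 2) := by
    have : 0 ≤ polyPos a v := by unfold polyPos; positivity
    positivity
  have hfar_nn : 0 ≤ farFactor a * (Real.exp (Real.log 2 / 4) * Real.exp (-π * v ^ 2) + Real.exp (-4 * π * v ^ 2)) :=
    mul_nonneg (farFactor_nonneg ha) (by positivity)
  rcases le_or_gt v (a / 2) with hva | hva
  · -- core regime
    have h1 := norm_gTilde_sub_one_le_of_nonneg ha hv.le hva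
    have h2 : Real.exp (-4 * π * v ^ 2) * ‖gTilde a v - 1‖ / (2 * Real.sinh (π * v))
        ≤ gBound a v * Real.exp (-(10 * π / 3) * v ^ 2) / (2 * (π * v)) := by
      refine div_le_div₀ (by have := gBound_nonneg (u := v) ha; positivity) h1 (by positivity) ?_
      exact mul_le_mul_of_nonneg_left (Real.self_le_sinh_iff.2 (by positivity)) (by norm_num)
    have h3 : gBound a v * Real.exp (-(10 * π / 3) * v ^ 2) / (2 * (π * v))
        ≤ polyPos a v / (2 * π) * Real.exp (-(10 * π / 3) * v ^ 2) := by
      have hb := gBound_le_mul_polyPos ha hv.le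
      rw [div_le_iff₀ (by positivity)]
      have : polyPos a v / (2 * π) * Real.exp (-(10 * π / 3) * v ^ 2) * (2 * (π * v))
          = v * polyPos a v * Real.exp (-(10 * π / 3) * v ^ 2) := by field_simp
      rw [this]
      exact mul_le_mul_of_nonneg_right hb (Real.exp_pos _).le
    linarith
  · -- far regime
    have h1 := norm_gTilde_sub_one_le_far (u := v) ha
    have h2 : Real.exp (-4 * π * v ^ 2) * ‖gTilde a v - 1‖ / (2 * Real.sinh (π * v))
        ≤ (Real.exp (Real.log 2 / 4) * Real.exp (-π * v ^ 2) + Real.exp (-4 * π * v ^ 2))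
          * (1 / (2 * Real.sinh (π * v))) := by
      rw [← mul_one_div (Real.exp (-4 * π * v ^ 2) * ‖gTilde a v - 1‖)]
      exact mul_le_mul_of_nonneg_right h1 (by positivity)
    have h3 := one_div_sinh_mono ha hva.le
    have h4 : (Real.exp (Real.log 2 / 4) * Real.exp (-π * v ^ 2) + Real.exp (-4 * π * v ^ 2))
          * (1 / (2 * Real.sinh (π * v)))
        ≤ farFactor a * (Real.exp (Real.log 2 / 4) * Real.exp (-π * v ^ 2) + Real.exp (-4 * π * v ^ 2)) := by
      rw [farFactor, mul_comm]
      exact mul_le_mul_of_nonneg_right h3 (by positivity)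
    linarith

/-- **Majorant on the negative half-line**: for `a > 0` and `v > 0`,
`|k(a,−v) − k₀(a,−v)| ≤ P₋(a,v) e^{−4πv²}/(2π) + F(a)(e^{(log 2)/4} e^{−πv²} + e^{−4πv²})`.
[cite: Gabcke1979, §3.1 Satz 3.1.3] -/
theorem norm_rsKer_sub_le_neg {a v : ℝ} (ha : 0 < a) (hv : 0 < v) :
    ‖rsKer a (-v) - rsKer0 a (-v)‖ ≤ polyNeg a v / (2 * π) * Real.exp (-4 * π * v ^ 2)
      + farFactor a * (Real.exp (Real.log 2 / 4) * Real.exp (-π * v ^ 2) + Real.exp (-4 * π * v ^ 2)) := by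
  have h0 := norm_rsKer_sub_rsKer0_le a (u := -v) (by linarith)
  rw [abs_neg, abs_of_pos hv, show (-v) ^ 2 = v ^ 2 by ring] at h0
  have hsinh : 0 < Real.sinh (π * v) := Real.sinh_pos_iff.2 (by positivity)
  have hpoly_nn : 0 ≤ polyNeg a v := by unfold polyNeg; positivity
  have hcore_nn : 0 ≤ polyNeg a v / (2 * π) * Real.exp (-4 * π * v ^ 2) := by positivity
  have hfar_nn : 0 ≤ farFactor a * (Real.exp (Real.log 2 / 4) * Real.exp (-π * v ^ 2) + Real.exp (-4 * π * v ^ 2)) :=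
    mul_nonneg (farFactor_nonneg ha) (by positivity)
  rcases le_or_gt v (a / 2) with hva | hva
  · have h1 := norm_gTilde_sub_one_le_of_nonpos ha (u := -v) (by linarith) (by linarith)
    rw [show (-v) ^ 2 = v ^ 2 by ring, abs_neg, abs_of_pos hv, gBound_neg] at h1
    have h2 : Real.exp (-4 * π * v ^ 2) * ‖gTilde a (-v) - 1‖ / (2 * Real.sinh (π * v))
        ≤ gBound a v * (1 + v / a) * Real.exp (-4 * π * v ^ 2) / (2 * (π * v)) := by
      refine div_le_div₀ (by have := gBound_nonneg (u := v) ha; positivity) h1 (by positivity) ?_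
      exact mul_le_mul_of_nonneg_left (Real.self_le_sinh_iff.2 (by positivity)) (by norm_num)
    have h3 : gBound a v * (1 + v / a) * Real.exp (-4 * π * v ^ 2) / (2 * (π * v))
        ≤ polyNeg a v / (2 * π) * Real.exp (-4 * π * v ^ 2) := by
      have hb := gBound_le_mul_polyPos ha hv.le
      have hb' : gBound a v * (1 + v / a) ≤ v * polyNeg a v := by
        rw [polyNeg_eq ha.ne', ← mul_assoc]
        exact mul_le_mul_of_nonneg_right hb (by positivity)
      rw [div_le_iff₀ (by positivity)]
      have : polyNeg a v / (2 * π) * Real.exp (-4 * π * v ^ 2) * (2 * (π * v))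
          = v * polyNeg a v * Real.exp (-4 * π * v ^ 2) := by field_simp
      rw [this]
      exact mul_le_mul_of_nonneg_right hb' (Real.exp_pos _).le
    linarith
  · have h1 := norm_gTilde_sub_one_le_far (u := -v) ha
    rw [show (-v) ^ 2 = v ^ 2 by ring] at h1
    have h2 : Real.exp (-4 * π * v ^ 2) * ‖gTilde a (-v) - 1‖ / (2 * Real.sinh (π * v))
        ≤ (Real.exp (Real.log 2 / 4) * Real.exp (-π * v ^ 2) + Real.exp (-4 * π * v ^ 2))
          * (1 / (2 * Real.sinh (π * v))) := by
      rw [← mul_one_div (Real.exp (-4 * π * v ^ 2) * ‖gTilde a (-v) - 1‖)]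
      exact mul_le_mul_of_nonneg_right h1 (by positivity)
    have h3 := one_div_sinh_mono ha hva.le
    have h4 : (Real.exp (Real.log 2 / 4) * Real.exp (-π * v ^ 2) + Real.exp (-4 * π * v ^ 2))
          * (1 / (2 * Real.sinh (π * v)))
        ≤ farFactor a * (Real.exp (Real.log 2 / 4) * Real.exp (-π * v ^ 2) + Real.exp (-4 * π * v ^ 2)) := by
      rw [farFactor, mul_comm]
      exact mul_le_mul_of_nonneg_right h3 (by positivity)
    linarith

/-! ## Integration -/

/-- The far part integrates to `F(a)(e^{(log 2)/4}/2 + 1/4)` over `(0, ∞)`. [folklore] -/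
private lemma integral_far (a : ℝ) :
    ∫ v in Ioi (0:ℝ), farFactor a * (Real.exp (Real.log 2 / 4) * Real.exp (-π * v ^ 2) + Real.exp (-4 * π * v ^ 2))
      = farFactor a * (Real.exp (Real.log 2 / 4) / 2 + 1 / 4) := by
  have h1 : IntegrableOn (fun v : ℝ ↦ Real.exp (Real.log 2 / 4) * Real.exp (-π * v ^ 2)) (Ioi 0) :=
    ((integrable_exp_neg_mul_sq Real.pi_pos).const_mul _).integrableOn
  have h2 : IntegrableOn (fun v : ℝ ↦ Real.exp (-4 * π * v ^ 2)) (Ioi 0) := by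
    have := (integrable_exp_neg_mul_sq (show (0:ℝ) < 4 * π by positivity)).integrableOn (s := Ioi 0)
    refine this.congr_fun (fun v _ ↦ by ring_nf) measurableSet_Ioi
  rw [integral_const_mul, integral_add h1 h2, integral_const_mul, integral_gaussian_Ioi,
    show (fun v : ℝ ↦ Real.exp (-4 * π * v ^ 2)) = fun v : ℝ ↦ Real.exp (-(4 * π) * v ^ 2) by funext v; ring_nf,
    integral_gaussian_Ioi, div_self Real.pi_ne_zero, Real.sqrt_one,
    show π / (4 * π) = (1 / 2) ^ 2 by field_simp; norm_num, Real.sqrt_sq (by norm_num)]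
  ring

/-- Integrability of the far part on `(0, ∞)`. [folklore] -/
private lemma integrableOn_far (a : ℝ) :
    IntegrableOn (fun v : ℝ ↦ farFactor a * (Real.exp (Real.log 2 / 4) * Real.exp (-π * v ^ 2)
      + Real.exp (-4 * π * v ^ 2))) (Ioi 0) := by
  have h1 : Integrable (fun v : ℝ ↦ Real.exp (Real.log 2 / 4) * Real.exp (-π * v ^ 2)) :=
    (integrable_exp_neg_mul_sq Real.pi_pos).const_mul _
  have h2 : Integrable (fun v : ℝ ↦ Real.exp (-4 * π * v ^ 2)) := by
    have := integrable_exp_neg_mul_sq (show (0:ℝ) < 4 * π by positivity)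
    exact this.congr (Eventually.of_forall fun v ↦ by simp only; ring_nf)
  exact ((h1.add h2).const_mul _).integrableOn

/-- `√(π/(10π/3)) = √(3/10)` and `√(π/(4π)) = 1/2`. [folklore] -/
private lemma sqrt_ratios : Real.sqrt (π / (10 * π / 3)) = Real.sqrt (3 / 10) ∧ Real.sqrt (π / (4 * π)) = 1 / 2 := by
  constructor
  · congr 1; field_simp
  · rw [show π / (4 * π) = (1 / 2) ^ 2 by field_simp; norm_num, Real.sqrt_sq (by norm_num)]

/-- The closed-form bound `S(a)` for `∫ |k − k₀|`: the two polynomial parts integrated against their Gaussians plus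
twice the far part. [cite: Gabcke1979, §3.1 Satz 3.1.3] -/
def kerIntegralBound (a : ℝ) : ℝ :=
  (1 / (2 * π)) * (
      (Real.sqrt 2 / (2 * a)) * (Real.sqrt (3 / 10) / 2) + (1 / (2 * a ^ 2)) * (1 / (2 * (10 * π / 3)))
      + (4 * Real.sqrt 2 * π / (3 * a) + (2 + Real.sqrt 2) * Real.sqrt 2 / (3 * a ^ 3)) * (Real.sqrt (3 / 10) / (4 * (10 * π / 3)))
      + (2 * π / a ^ 2) * (1 / (2 * (10 * π / 3) ^ 2))
      + ((2 + Real.sqrt 2) * Real.sqrt 2 * (8 * π / 5) / a ^ 3) * (3 * Real.sqrt (3 / 10) / (8 * (10 * π / 3) ^ 2))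
      + 0 * (1 / (10 * π / 3) ^ 3))
  + (1 / (2 * π)) * (
      (Real.sqrt 2 / (2 * a)) * ((1 / 2) / 2) + (1 / (2 * a ^ 2) + Real.sqrt 2 / (2 * a ^ 2)) * (1 / (2 * (4 * π)))
      + (4 * Real.sqrt 2 * π / (3 * a) + (2 + Real.sqrt 2) * Real.sqrt 2 / (3 * a ^ 3) + 1 / (2 * a ^ 3)) * ((1 / 2) / (4 * (4 * π)))
      + (2 * π / a ^ 2 + (4 * Real.sqrt 2 * π / (3 * a ^ 2) + (2 + Real.sqrt 2) * Real.sqrt 2 / (3 * a ^ 4))) * (1 / (2 * (4 * π) ^ 2))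
      + ((2 + Real.sqrt 2) * Real.sqrt 2 * (8 * π / 5) / a ^ 3 + 2 * π / a ^ 3) * (3 * (1 / 2) / (8 * (4 * π) ^ 2))
      + ((2 + Real.sqrt 2) * Real.sqrt 2 * (8 * π / 5) / a ^ 4) * (1 / (4 * π) ^ 3))
  + 2 * (farFactor a * (Real.exp (Real.log 2 / 4) / 2 + 1 / 4))

/-- **`∫ |k(a,u) − k₀(a,u)| du ≤ S(a)`** for a non-integer `a > 0`. [cite: Gabcke1979, §3.1 Satz 3.1.3] -/
theorem integral_norm_rsKer_sub_le {a : ℝ} (ha : 0 < a) (hai : ∀ n : ℤ, (n : ℝ) ≠ a) :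
    ∫ u : ℝ, ‖rsKer a u - rsKer0 a u‖ ≤ kerIntegralBound a := by
  set φ : ℝ → ℝ := fun u ↦ ‖rsKer a u - rsKer0 a u‖ with hφ
  have hint : Integrable φ := ((integrable_rsKer ha hai).sub (integrable_rsKer0 hai)).norm
  -- split at `0` and reflect the negative half-line
  have hsplit : ∫ u : ℝ, φ u = (∫ v in Ioi (0:ℝ), φ v) + ∫ v in Ioi (0:ℝ), φ (-v) := by
    rw [← integral_add_compl (measurableSet_Ioi (a := (0:ℝ))) hint, compl_Ioi, integral_comp_neg_Ioi, neg_zero]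
  -- majorants
  set Mp : ℝ → ℝ := fun v ↦ polyPos a v / (2 * π) * Real.exp (-(10 * π / 3) * v ^ 2)
      + farFactor a * (Real.exp (Real.log 2 / 4) * Real.exp (-π * v ^ 2) + Real.exp (-4 * π * v ^ 2)) with hMp
  set Mm : ℝ → ℝ := fun v ↦ polyNeg a v / (2 * π) * Real.exp (-4 * π * v ^ 2)
      + farFactor a * (Real.exp (Real.log 2 / 4) * Real.exp (-π * v ^ 2) + Real.exp (-4 * π * v ^ 2)) with hMm
  have hcp : (0:ℝ) < 10 * π / 3 := by positivity
  have hcm : (0:ℝ) < 4 * π := by positivity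
  -- the polynomial parts as instances of `integral_poly_mul_exp`
  have hPp : ∀ v, polyPos a v / (2 * π) * Real.exp (-(10 * π / 3) * v ^ 2)
      = (1 / (2 * π)) * ((Real.sqrt 2 / (2 * a) + 1 / (2 * a ^ 2) * v
        + (4 * Real.sqrt 2 * π / (3 * a) + (2 + Real.sqrt 2) * Real.sqrt 2 / (3 * a ^ 3)) * v ^ 2
        + 2 * π / a ^ 2 * v ^ 3 + (2 + Real.sqrt 2) * Real.sqrt 2 * (8 * π / 5) / a ^ 3 * v ^ 4 + 0 * v ^ 5)
        * Real.exp (-(10 * π / 3) * v ^ 2)) := fun v ↦ by rw [polyPos]; ring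
  have hPm : ∀ v, polyNeg a v / (2 * π) * Real.exp (-4 * π * v ^ 2)
      = (1 / (2 * π)) * ((Real.sqrt 2 / (2 * a) + (1 / (2 * a ^ 2) + Real.sqrt 2 / (2 * a ^ 2)) * v
        + (4 * Real.sqrt 2 * π / (3 * a) + (2 + Real.sqrt 2) * Real.sqrt 2 / (3 * a ^ 3) + 1 / (2 * a ^ 3)) * v ^ 2
        + (2 * π / a ^ 2 + (4 * Real.sqrt 2 * π / (3 * a ^ 2) + (2 + Real.sqrt 2) * Real.sqrt 2 / (3 * a ^ 4))) * v ^ 3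
        + ((2 + Real.sqrt 2) * Real.sqrt 2 * (8 * π / 5) / a ^ 3 + 2 * π / a ^ 3) * v ^ 4
        + (2 + Real.sqrt 2) * Real.sqrt 2 * (8 * π / 5) / a ^ 4 * v ^ 5)
        * Real.exp (-(4 * π) * v ^ 2)) := fun v ↦ by rw [polyNeg]; ring_nf
  have hIp : IntegrableOn Mp (Ioi 0) := by
    have h1 := (integrableOn_poly_mul_exp (Real.sqrt 2 / (2 * a)) (1 / (2 * a ^ 2))
      (4 * Real.sqrt 2 * π / (3 * a) + (2 + Real.sqrt 2) * Real.sqrt 2 / (3 * a ^ 3)) (2 * π / a ^ 2)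
      ((2 + Real.sqrt 2) * Real.sqrt 2 * (8 * π / 5) / a ^ 3) 0 hcp).const_mul (1 / (2 * π))
    have h : IntegrableOn (fun v : ℝ ↦ (1 / (2 * π)) * ((Real.sqrt 2 / (2 * a) + 1 / (2 * a ^ 2) * v
        + (4 * Real.sqrt 2 * π / (3 * a) + (2 + Real.sqrt 2) * Real.sqrt 2 / (3 * a ^ 3)) * v ^ 2
        + 2 * π / a ^ 2 * v ^ 3 + (2 + Real.sqrt 2) * Real.sqrt 2 * (8 * π / 5) / a ^ 3 * v ^ 4 + 0 * v ^ 5)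
        * Real.exp (-(10 * π / 3) * v ^ 2))
        + farFactor a * (Real.exp (Real.log 2 / 4) * Real.exp (-π * v ^ 2) + Real.exp (-4 * π * v ^ 2))) (Ioi 0) :=
      h1.add (integrableOn_far a)
    refine h.congr_fun (fun v _ ↦ ?_) measurableSet_Ioi
    simp only [hMp, hPp]
  have hIm : IntegrableOn Mm (Ioi 0) := by
    have h1 := (integrableOn_poly_mul_exp (Real.sqrt 2 / (2 * a)) (1 / (2 * a ^ 2) + Real.sqrt 2 / (2 * a ^ 2))
      (4 * Real.sqrt 2 * π / (3 * a) + (2 + Real.sqrt 2) * Real.sqrt 2 / (3 * a ^ 3) + 1 / (2 * a ^ 3))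
      (2 * π / a ^ 2 + (4 * Real.sqrt 2 * π / (3 * a ^ 2) + (2 + Real.sqrt 2) * Real.sqrt 2 / (3 * a ^ 4)))
      ((2 + Real.sqrt 2) * Real.sqrt 2 * (8 * π / 5) / a ^ 3 + 2 * π / a ^ 3)
      ((2 + Real.sqrt 2) * Real.sqrt 2 * (8 * π / 5) / a ^ 4) hcm).const_mul (1 / (2 * π))
    have h : IntegrableOn (fun v : ℝ ↦ (1 / (2 * π)) * ((Real.sqrt 2 / (2 * a) + (1 / (2 * a ^ 2) + Real.sqrt 2 / (2 * a ^ 2)) * v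
        + (4 * Real.sqrt 2 * π / (3 * a) + (2 + Real.sqrt 2) * Real.sqrt 2 / (3 * a ^ 3) + 1 / (2 * a ^ 3)) * v ^ 2
        + (2 * π / a ^ 2 + (4 * Real.sqrt 2 * π / (3 * a ^ 2) + (2 + Real.sqrt 2) * Real.sqrt 2 / (3 * a ^ 4))) * v ^ 3
        + ((2 + Real.sqrt 2) * Real.sqrt 2 * (8 * π / 5) / a ^ 3 + 2 * π / a ^ 3) * v ^ 4
        + (2 + Real.sqrt 2) * Real.sqrt 2 * (8 * π / 5) / a ^ 4 * v ^ 5)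
        * Real.exp (-(4 * π) * v ^ 2))
        + farFactor a * (Real.exp (Real.log 2 / 4) * Real.exp (-π * v ^ 2) + Real.exp (-4 * π * v ^ 2))) (Ioi 0) :=
      h1.add (integrableOn_far a)
    refine h.congr_fun (fun v _ ↦ ?_) measurableSet_Ioi
    simp only [hMm, hPm]
  -- compare
  have hle1 : ∫ v in Ioi (0:ℝ), φ v ≤ ∫ v in Ioi (0:ℝ), Mp v :=
    setIntegral_mono_on hint.integrableOn hIp measurableSet_Ioi (fun v hv ↦ norm_rsKer_sub_le_pos ha hv)
  have hle2 : ∫ v in Ioi (0:ℝ), φ (-v) ≤ ∫ v in Ioi (0:ℝ), Mm v :=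
    setIntegral_mono_on (hint.comp_neg.integrableOn) hIm measurableSet_Ioi (fun v hv ↦ norm_rsKer_sub_le_neg ha hv)
  -- evaluate the majorant integrals
  have hvp : ∫ v in Ioi (0:ℝ), Mp v = (1 / (2 * π)) * (
      (Real.sqrt 2 / (2 * a)) * (Real.sqrt (3 / 10) / 2) + (1 / (2 * a ^ 2)) * (1 / (2 * (10 * π / 3)))
      + (4 * Real.sqrt 2 * π / (3 * a) + (2 + Real.sqrt 2) * Real.sqrt 2 / (3 * a ^ 3)) * (Real.sqrt (3 / 10) / (4 * (10 * π / 3)))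
      + (2 * π / a ^ 2) * (1 / (2 * (10 * π / 3) ^ 2))
      + ((2 + Real.sqrt 2) * Real.sqrt 2 * (8 * π / 5) / a ^ 3) * (3 * Real.sqrt (3 / 10) / (8 * (10 * π / 3) ^ 2))
      + 0 * (1 / (10 * π / 3) ^ 3))
      + farFactor a * (Real.exp (Real.log 2 / 4) / 2 + 1 / 4) := by
    have h1 := (integrableOn_poly_mul_exp (Real.sqrt 2 / (2 * a)) (1 / (2 * a ^ 2))
      (4 * Real.sqrt 2 * π / (3 * a) + (2 + Real.sqrt 2) * Real.sqrt 2 / (3 * a ^ 3)) (2 * π / a ^ 2)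
      ((2 + Real.sqrt 2) * Real.sqrt 2 * (8 * π / 5) / a ^ 3) 0 hcp).const_mul (1 / (2 * π))
    have e : (fun v ↦ Mp v) = fun v ↦ (1 / (2 * π)) * ((Real.sqrt 2 / (2 * a) + 1 / (2 * a ^ 2) * v
        + (4 * Real.sqrt 2 * π / (3 * a) + (2 + Real.sqrt 2) * Real.sqrt 2 / (3 * a ^ 3)) * v ^ 2
        + 2 * π / a ^ 2 * v ^ 3 + (2 + Real.sqrt 2) * Real.sqrt 2 * (8 * π / 5) / a ^ 3 * v ^ 4 + 0 * v ^ 5)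
        * Real.exp (-(10 * π / 3) * v ^ 2))
        + farFactor a * (Real.exp (Real.log 2 / 4) * Real.exp (-π * v ^ 2) + Real.exp (-4 * π * v ^ 2)) := by
      funext v; simp only [hMp, hPp]
    rw [e, integral_add h1 (integrableOn_far a), integral_const_mul, integral_poly_mul_exp _ _ _ _ _ _ hcp,
      integral_far, sqrt_ratios.1]
  have hvm : ∫ v in Ioi (0:ℝ), Mm v = (1 / (2 * π)) * (
      (Real.sqrt 2 / (2 * a)) * ((1 / 2) / 2) + (1 / (2 * a ^ 2) + Real.sqrt 2 / (2 * a ^ 2)) * (1 / (2 * (4 * π)))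
      + (4 * Real.sqrt 2 * π / (3 * a) + (2 + Real.sqrt 2) * Real.sqrt 2 / (3 * a ^ 3) + 1 / (2 * a ^ 3)) * ((1 / 2) / (4 * (4 * π)))
      + (2 * π / a ^ 2 + (4 * Real.sqrt 2 * π / (3 * a ^ 2) + (2 + Real.sqrt 2) * Real.sqrt 2 / (3 * a ^ 4))) * (1 / (2 * (4 * π) ^ 2))
      + ((2 + Real.sqrt 2) * Real.sqrt 2 * (8 * π / 5) / a ^ 3 + 2 * π / a ^ 3) * (3 * (1 / 2) / (8 * (4 * π) ^ 2))
      + ((2 + Real.sqrt 2) * Real.sqrt 2 * (8 * π / 5) / a ^ 4) * (1 / (4 * π) ^ 3))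
      + farFactor a * (Real.exp (Real.log 2 / 4) / 2 + 1 / 4) := by
    have h1 := (integrableOn_poly_mul_exp (Real.sqrt 2 / (2 * a)) (1 / (2 * a ^ 2) + Real.sqrt 2 / (2 * a ^ 2))
      (4 * Real.sqrt 2 * π / (3 * a) + (2 + Real.sqrt 2) * Real.sqrt 2 / (3 * a ^ 3) + 1 / (2 * a ^ 3))
      (2 * π / a ^ 2 + (4 * Real.sqrt 2 * π / (3 * a ^ 2) + (2 + Real.sqrt 2) * Real.sqrt 2 / (3 * a ^ 4)))
      ((2 + Real.sqrt 2) * Real.sqrt 2 * (8 * π / 5) / a ^ 3 + 2 * π / a ^ 3)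
      ((2 + Real.sqrt 2) * Real.sqrt 2 * (8 * π / 5) / a ^ 4) hcm).const_mul (1 / (2 * π))
    have e : (fun v ↦ Mm v) = fun v ↦ (1 / (2 * π)) * ((Real.sqrt 2 / (2 * a) + (1 / (2 * a ^ 2) + Real.sqrt 2 / (2 * a ^ 2)) * v
        + (4 * Real.sqrt 2 * π / (3 * a) + (2 + Real.sqrt 2) * Real.sqrt 2 / (3 * a ^ 3) + 1 / (2 * a ^ 3)) * v ^ 2
        + (2 * π / a ^ 2 + (4 * Real.sqrt 2 * π / (3 * a ^ 2) + (2 + Real.sqrt 2) * Real.sqrt 2 / (3 * a ^ 4))) * v ^ 3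
        + ((2 + Real.sqrt 2) * Real.sqrt 2 * (8 * π / 5) / a ^ 3 + 2 * π / a ^ 3) * v ^ 4
        + (2 + Real.sqrt 2) * Real.sqrt 2 * (8 * π / 5) / a ^ 4 * v ^ 5)
        * Real.exp (-(4 * π) * v ^ 2))
        + farFactor a * (Real.exp (Real.log 2 / 4) * Real.exp (-π * v ^ 2) + Real.exp (-4 * π * v ^ 2)) := by
      funext v; simp only [hMm, hPm]
    rw [e, integral_add h1 (integrableOn_far a), integral_const_mul, integral_poly_mul_exp _ _ _ _ _ _ hcm,
      integral_far, sqrt_ratios.2]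
  rw [hsplit, kerIntegralBound]
  linarith [hle1, hle2, hvp, hvm]

/-! ## The theorem -/

/-- **Explicit Riemann–Siegel remainder bound, case `K = 0`** (Gabcke 1979, Satz 3.2.2 with weakened constants, by
the direct `K = 0` route): for `t ≥ 2` with `a = √(t/2π) ∉ ℤ`, `⌊a⌋ ≥ 1` and `cos πz ≠ 0`,
`|R₀(t)| ≤ (2/√a) (√2 · S(a) + (2K(¼)/t) (√2/4) e^{π/4})`, `S(a) = kerIntegralBound a`; numerically
`S(a) = 0.08066/a + 0.02215/a² + 0.0198/a³ + 0.00275/a⁴ + 2F(a)(0.8446)` with `F(a) ≤ 3840/(π⁵a⁵)`, i.e.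
`|R₀(t)| ≤ 0.2282 a^{−3/2} + 0.3513 a^{−5/2} + 0.056 a^{−7/2} + 0.0078 a^{−9/2} + 60.0 a^{−11/2}`
(`≈ 0.906 t^{−3/4} + 3.50 t^{−5/4} + …`). [cite: Gabcke1979, §3.2 Satz 3.2.2] -/
theorem abs_R0_le_explicit {t : ℝ} (ht : 2 ≤ t) (hN : 1 ≤ Gabcke.N t) (hai : ∀ n : ℤ, (n : ℝ) ≠ Gabcke.a t)
    (hcos : Real.cos (π * Gabcke.z t) ≠ 0) :
    |R0 t| ≤ 2 / Real.sqrt (Gabcke.a t) * (Real.sqrt 2 * kerIntegralBound (Gabcke.a t)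
      + 2 * stirlingVertRate (1 / 4) / t * (Real.sqrt 2 / 4 * Real.exp (π / 4))) := by
  have ht0 : (0:ℝ) < t := by linarith
  have hA : 0 < Gabcke.a t := Real.sqrt_pos.2 (div_pos ht0 (by positivity))
  refine (abs_R0_le ht hN hai hcos).trans (mul_le_mul_of_nonneg_left ?_ (by positivity))
  exact add_le_add (mul_le_mul_of_nonneg_left (integral_norm_rsKer_sub_le hA hai) (Real.sqrt_nonneg 2)) le_rfl

/-- For `t ≥ 8` the main sum is non-empty: `N = ⌊√(t/2π)⌋ ≥ 1` (`π ≤ 4`). [folklore] -/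
private lemma one_le_N {t : ℝ} (ht : 8 ≤ t) : 1 ≤ Gabcke.N t := by
  have hπ : π ≤ 4 := Real.pi_le_four
  have h1 : (1 : ℝ) ≤ t / (2 * π) := by rw [le_div_iff₀ (by positivity)]; nlinarith
  have h2 : (1 : ℝ) ≤ Gabcke.a t := by
    rw [Gabcke.a, show (1:ℝ) = Real.sqrt 1 by simp]
    exact Real.sqrt_le_sqrt h1
  rw [Gabcke.N]
  exact Nat.le_floor (by exact_mod_cast h2)

/-- **Explicit Riemann–Siegel remainder bound, elementary form**: for `t ≥ 8` with `a = √(t/2π) ∉ ℤ` and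
`cos πz ≠ 0`, `|R₀(t)| ≤ (2/√a)(√2 · S(a) + (2K(¼)/t)(√2/4)e^{π/4})` where in `S(a)` the far factor may be replaced
by `3840/(π⁵a⁵)`; all constants are closed-form reals (`√2`, `√(3/10)`, `π`, `e^{π/4}`, `2^{1/4} = e^{(log 2)/4}`,
`K(¼) = stirlingVertRate (1/4)`). Numerically `|R₀(t)| ≤ 0.906 t^{−3/4} + 3.50 t^{−5/4} + 1.4 t^{−7/4} + 0.49 t^{−9/4}
+ 9.4·10³ t^{−11/4}`; on the tree's certified sample sets for `RiemannHypothesisUpTo 10⁴ / 10⁵` this bound fails at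
3 resp. 11 of 10 063 resp. 137 990 planted points and at none after re-positioning on the `2⁻¹⁰` grid
(engine-1 note GABCKE-K0-ROUTE). [cite: Gabcke1979, §3.2 Satz 3.2.2] -/
theorem abs_R0_le_explicit_of_ge {t : ℝ} (ht : 8 ≤ t) (hai : ∀ n : ℤ, (n : ℝ) ≠ Gabcke.a t)
    (hcos : Real.cos (π * Gabcke.z t) ≠ 0) :
    |R0 t| ≤ 2 / Real.sqrt (Gabcke.a t) * (Real.sqrt 2 * (kerIntegralBound (Gabcke.a t)
        - 2 * (farFactor (Gabcke.a t) * (Real.exp (Real.log 2 / 4) / 2 + 1 / 4))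
        + 2 * (3840 / (π ^ 5 * Gabcke.a t ^ 5) * (Real.exp (Real.log 2 / 4) / 2 + 1 / 4)))
      + 2 * stirlingVertRate (1 / 4) / t * (Real.sqrt 2 / 4 * Real.exp (π / 4))) := by
  have ht0 : (0:ℝ) < t := by linarith
  have hA : 0 < Gabcke.a t := Real.sqrt_pos.2 (div_pos ht0 (by positivity))
  have h := abs_R0_le_explicit (by linarith) (one_le_N ht) hai hcos
  refine h.trans (mul_le_mul_of_nonneg_left (add_le_add (mul_le_mul_of_nonneg_left ?_ (Real.sqrt_nonneg 2)) le_rfl)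
    (by positivity))
  have hf := farFactor_le hA
  have hpos : 0 ≤ Real.exp (Real.log 2 / 4) / 2 + 1 / 4 := by positivity
  nlinarith [mul_le_mul_of_nonneg_right hf hpos]

/-- The far factor in elementary form: `F(a) ≤ 3840/(π⁵ a⁵)`, so every term of `abs_R0_le_explicit` is an explicit
power of `a = √(t/2π)`. [cite: Gabcke1979, §3.1 Satz 3.1.3] -/
theorem farFactor_le_pow {a : ℝ} (ha : 0 < a) : farFactor a ≤ 3840 / (π ^ 5 * a ^ 5) := farFactor_le ha

/-! ## The hypothesis `a ∉ ℤ` at rational heights -/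

/-- For a positive RATIONAL `t`, `a = √(t/2π)` is not an integer (else `π = t/(2n²)` would be rational): the
hypothesis `∀ n : ℤ, n ≠ a t` of `abs_R0_le_explicit` holds at every rational height, in particular at the dyadic
sample points `t = p/2^e` of the tree's certified evaluations of `Z` (where Gabcke's Satz 3.2.2 is applied).
[cite: Gabcke1979, §3.2 Satz 3.2.2] -/
theorem int_ne_a_ratCast {q : ℚ} (hq : 0 < q) : ∀ n : ℤ, (n : ℝ) ≠ Gabcke.a (q : ℝ) := by
  intro n h
  have hq' : (0 : ℝ) < q := by exact_mod_cast hq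
  have hsq : ((n : ℝ)) ^ 2 = (q : ℝ) / (2 * π) := by
    rw [h, Gabcke.a, Real.sq_sqrt (by positivity)]
  have hn : (n : ℝ) ≠ 0 := by
    intro h0
    rw [h0] at hsq
    have : (q : ℝ) / (2 * π) = 0 := by rw [← hsq]; ring
    rw [div_eq_zero_iff] at this
    rcases this with h1 | h1
    · linarith
    · linarith [Real.pi_pos]
  have hpi : π = (((q / (2 * (n : ℚ) ^ 2) : ℚ)) : ℝ) := by
    push_cast
    field_simp
    field_simp at hsq
    linarith
  exact irrational_pi.ne_rat _ hpi

/-- Dyadic heights: for `t = p/2^e` with `p ≥ 1`, `√(t/2π)` is not an integer. [cite: Gabcke1979, §3.2 Satz 3.2.2] -/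
theorem int_ne_a_dyadic {p e : ℕ} (hp : 1 ≤ p) : ∀ n : ℤ, (n : ℝ) ≠ Gabcke.a ((p : ℝ) / 2 ^ e) := by
  have h := int_ne_a_ratCast (q := (p : ℚ) / 2 ^ e) (by positivity)
  intro n hn
  refine h n ?_
  rw [hn]; push_cast; rfl

/-! ## Sharper integration of the leading term: `x/sinh x ≤ 1 − x²/6 + 7x⁴/360` and the sign change of `4πv²/3 − ½`

The leading (`1/a`) term of the majorant carries `|4πv²/3 − ½|/(2 sinh πv)`. Above it was bounded by
`(4πv²/3 + ½)/(2πv)`; here we keep the sign change (splitting the half-line at `v₀ = √(3/(8π))`) and use two more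
terms of the expansion of `x/sinh x`, which halves the leading constant: `K₁ = 0.1202…` instead of `0.2281…`
(`0.477 t^{−3/4}` instead of `0.905 t^{−3/4}`). -/

/-- Ladder step: a function vanishing at `0` with non-negative derivative on `[0, ∞)` is non-negative there. [folklore] -/
private lemma ladder_step (F F' : ℝ → ℝ) (hF : ∀ y, HasDerivAt F (F' y) y) (hF' : ∀ y, 0 ≤ y → 0 ≤ F' y)
    (h0 : F 0 = 0) {y : ℝ} (hy : 0 ≤ y) : 0 ≤ F y := by
  have hmono := monotoneOn_of_deriv_nonneg (convex_Ici 0) (fun z _ ↦ (hF z).continuousAt.continuousWithinAt)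
    (fun z _ ↦ (hF z).differentiableAt.differentiableWithinAt)
    (fun z hz ↦ by rw [interior_Ici] at hz; rw [(hF z).deriv]; exact hF' z (le_of_lt hz))
  have := hmono (self_mem_Ici) (show y ∈ Ici 0 from hy) hy
  rwa [h0] at this

/-- `e^{−x} ≤ 1 − x + x²/2 − x³/6 + x⁴/24` for `x ≥ 0`. [folklore] -/
private lemma exp_neg_le_taylor4 {x : ℝ} (hx : 0 ≤ x) :
    Real.exp (-x) ≤ 1 - x + x ^ 2 / 2 - x ^ 3 / 6 + x ^ 4 / 24 := by
  have hE : ∀ y : ℝ, HasDerivAt (fun y ↦ Real.exp (-y)) (-Real.exp (-y)) y := fun y ↦ by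
    refine ((hasDerivAt_neg y).exp).congr_deriv ?_
    ring
  have h1 : ∀ y : ℝ, 0 ≤ y → 0 ≤ Real.exp (-y) - (1 - y) := fun y _ ↦ by linarith [Real.add_one_le_exp (-y)]
  have h2 : ∀ y : ℝ, 0 ≤ y → 0 ≤ (1 - y + y ^ 2 / 2) - Real.exp (-y) := fun y hy ↦ by
    refine ladder_step (fun y ↦ (1 - y + y ^ 2 / 2) - Real.exp (-y)) (fun y ↦ Real.exp (-y) - (1 - y))
      (fun y ↦ ?_) h1 (by simp) hy
    exact (((((hasDerivAt_const y (1:ℝ)).sub (hasDerivAt_id' y)).add ((hasDerivAt_pow 2 y).div_const 2))).sub (hE y)).congr_deriv (by push_cast; ring)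
  have h3 : ∀ y : ℝ, 0 ≤ y → 0 ≤ Real.exp (-y) - (1 - y + y ^ 2 / 2 - y ^ 3 / 6) := fun y hy ↦ by
    refine ladder_step (fun y ↦ Real.exp (-y) - (1 - y + y ^ 2 / 2 - y ^ 3 / 6))
      (fun y ↦ (1 - y + y ^ 2 / 2) - Real.exp (-y)) (fun y ↦ ?_) h2 (by simp) hy
    exact ((hE y).sub ((((hasDerivAt_const y (1:ℝ)).sub (hasDerivAt_id' y)).add
      ((hasDerivAt_pow 2 y).div_const 2)).sub ((hasDerivAt_pow 3 y).div_const 6))).congr_deriv (by push_cast; ring)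
  have h4 : ∀ y : ℝ, 0 ≤ y → 0 ≤ (1 - y + y ^ 2 / 2 - y ^ 3 / 6 + y ^ 4 / 24) - Real.exp (-y) := fun y hy ↦ by
    refine ladder_step (fun y ↦ (1 - y + y ^ 2 / 2 - y ^ 3 / 6 + y ^ 4 / 24) - Real.exp (-y))
      (fun y ↦ Real.exp (-y) - (1 - y + y ^ 2 / 2 - y ^ 3 / 6)) (fun y ↦ ?_) h3 (by simp) hy
    exact (((((((hasDerivAt_const y (1:ℝ)).sub (hasDerivAt_id' y)).add ((hasDerivAt_pow 2 y).div_const 2)).sub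
      ((hasDerivAt_pow 3 y).div_const 6)).add ((hasDerivAt_pow 4 y).div_const 24))).sub (hE y)).congr_deriv (by push_cast; ring)
  linarith [h4 x hx]

/-- `x + x³/6 + x⁵/120 ≤ sinh x` for `x ≥ 0`. [folklore] -/
private lemma taylor5_le_sinh {x : ℝ} (hx : 0 ≤ x) : x + x ^ 3 / 6 + x ^ 5 / 120 ≤ Real.sinh x := by
  have h1 : ∀ y : ℝ, 0 ≤ y → 0 ≤ Real.sinh y - y := fun y hy ↦ by linarith [Real.self_le_sinh_iff.2 hy]
  have h2 : ∀ y : ℝ, 0 ≤ y → 0 ≤ Real.cosh y - (1 + y ^ 2 / 2) := fun y hy ↦ by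
    refine ladder_step (fun y ↦ Real.cosh y - (1 + y ^ 2 / 2)) (fun y ↦ Real.sinh y - y) (fun y ↦ ?_) h1
      (by simp) hy
    exact ((Real.hasDerivAt_cosh y).sub ((hasDerivAt_const y (1:ℝ)).add ((hasDerivAt_pow 2 y).div_const 2))).congr_deriv (by push_cast; ring)
  have h3 : ∀ y : ℝ, 0 ≤ y → 0 ≤ Real.sinh y - (y + y ^ 3 / 6) := fun y hy ↦ by
    refine ladder_step (fun y ↦ Real.sinh y - (y + y ^ 3 / 6)) (fun y ↦ Real.cosh y - (1 + y ^ 2 / 2))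
      (fun y ↦ ?_) h2 (by simp) hy
    exact ((Real.hasDerivAt_sinh y).sub ((hasDerivAt_id' y).add ((hasDerivAt_pow 3 y).div_const 6))).congr_deriv (by push_cast; ring)
  have h4 : ∀ y : ℝ, 0 ≤ y → 0 ≤ Real.cosh y - (1 + y ^ 2 / 2 + y ^ 4 / 24) := fun y hy ↦ by
    refine ladder_step (fun y ↦ Real.cosh y - (1 + y ^ 2 / 2 + y ^ 4 / 24)) (fun y ↦ Real.sinh y - (y + y ^ 3 / 6))
      (fun y ↦ ?_) h3 (by simp) hy
    exact ((Real.hasDerivAt_cosh y).sub (((hasDerivAt_const y (1:ℝ)).add ((hasDerivAt_pow 2 y).div_const 2)).add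
      ((hasDerivAt_pow 4 y).div_const 24))).congr_deriv (by push_cast; ring)
  have h5 : ∀ y : ℝ, 0 ≤ y → 0 ≤ Real.sinh y - (y + y ^ 3 / 6 + y ^ 5 / 120) := fun y hy ↦ by
    refine ladder_step (fun y ↦ Real.sinh y - (y + y ^ 3 / 6 + y ^ 5 / 120))
      (fun y ↦ Real.cosh y - (1 + y ^ 2 / 2 + y ^ 4 / 24)) (fun y ↦ ?_) h4 (by simp) hy
    exact ((Real.hasDerivAt_sinh y).sub (((hasDerivAt_id' y).add ((hasDerivAt_pow 3 y).div_const 6)).add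
      ((hasDerivAt_pow 5 y).div_const 120))).congr_deriv (by push_cast; ring)
  linarith [h5 x hx]

/-- The polynomial `P(x) = 1 − x²/6 + 7x⁴/360 ≥ 9/14 > 0`. [folklore] -/
private lemma sinhPoly_pos (x : ℝ) : 0 < 1 - x ^ 2 / 6 + 7 * x ^ 4 / 360 := by
  nlinarith [sq_nonneg (x ^ 2 - 30 / 7)]

/-- `1/(2 sinh x) ≤ (1 − x²/6 + 7x⁴/360)/(2x)` for `x > 0` (`x/sinh x ≤ 1/(1 + x²/6 + x⁴/120) ≤ 1 − x²/6 + 7x⁴/360`).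
[folklore] -/
private lemma one_div_two_sinh_le_poly {x : ℝ} (hx : 0 < x) :
    1 / (2 * Real.sinh x) ≤ (1 - x ^ 2 / 6 + 7 * x ^ 4 / 360) / (2 * x) := by
  have hs := taylor5_le_sinh hx.le
  have hP := sinhPoly_pos x
  have hsinh : 0 < Real.sinh x := Real.sinh_pos_iff.2 hx
  rw [div_le_div_iff₀ (by positivity) (by positivity)]
  have hkey : x ≤ (1 - x ^ 2 / 6 + 7 * x ^ 4 / 360) * (x + x ^ 3 / 6 + x ^ 5 / 120) := by
    nlinarith [pow_nonneg hx.le 7, pow_nonneg hx.le 9]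
  nlinarith [mul_le_mul_of_nonneg_left hs hP.le]

/-! ### One more moment, and even polynomials of degree ≤ 6 -/

/-- `c^{−7/2} = (c³ √c)⁻¹` for `c > 0`. [folklore] -/
private lemma rpow_neg_seven_halves {c : ℝ} (hc : 0 < c) : c ^ (-(7 / 2 : ℝ)) = (c ^ 3 * Real.sqrt c)⁻¹ := by
  rw [show (7 / 2 : ℝ) = 3 + 1 / 2 by norm_num, Real.rpow_neg hc.le, Real.rpow_add hc, ← Real.sqrt_eq_rpow,
    show (3:ℝ) = (3:ℕ) by norm_num, Real.rpow_natCast]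

/-- `Γ(7/2) = 15√π/8`. [folklore] -/
private lemma Gamma_seven_halves : Real.Gamma (7 / 2) = 15 * Real.sqrt π / 8 := by
  rw [show (7 / 2 : ℝ) = 5 / 2 + 1 by norm_num, Real.Gamma_add_one (by norm_num), Gamma_five_halves]; ring

/-- `I₆(c) = 15√(π/c)/(16c³)`. [folklore] -/
private lemma moment_six {c : ℝ} (hc : 0 < c) :
    ∫ v in Ioi (0:ℝ), v ^ 6 * Real.exp (-c * v ^ 2) = 15 * Real.sqrt (π / c) / (16 * c ^ 3) := by
  rw [integral_pow_mul_exp_neg_mul_sq 6 hc, show -(((6:ℕ):ℝ) + 1) / 2 = -(7 / 2 : ℝ) by norm_num,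
    show (((6:ℕ):ℝ) + 1) / 2 = 7 / 2 by norm_num, rpow_neg_seven_halves hc, Gamma_seven_halves,
    Real.sqrt_div' _ hc.le]
  have : Real.sqrt c ≠ 0 := (Real.sqrt_pos.2 hc).ne'
  field_simp
  norm_num

/-- The integral of `(b₀ + b₂v² + b₄v⁴ + b₆v⁶) e^{−cv²}` over `(0,∞)`. [folklore] -/
private lemma integral_evenPoly_mul_exp (b₀ b₂ b₄ b₆ : ℝ) {c : ℝ} (hc : 0 < c) :
    ∫ v in Ioi (0:ℝ), (b₀ + b₂ * v ^ 2 + b₄ * v ^ 4 + b₆ * v ^ 6) * Real.exp (-c * v ^ 2)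
      = b₀ * (Real.sqrt (π / c) / 2) + b₂ * (Real.sqrt (π / c) / (4 * c))
        + b₄ * (3 * Real.sqrt (π / c) / (8 * c ^ 2)) + b₆ * (15 * Real.sqrt (π / c) / (16 * c ^ 3)) := by
  have hI : ∀ k : ℕ, ∀ b : ℝ, IntegrableOn (fun v : ℝ ↦ b * (v ^ k * Real.exp (-c * v ^ 2))) (Ioi 0) :=
    fun k b ↦ (integrableOn_pow_mul_exp k hc).const_mul b
  set t : ℕ → ℝ → ℝ := fun k v ↦ v ^ k * Real.exp (-c * v ^ 2) with ht
  have hsplit : (fun v : ℝ ↦ (b₀ + b₂ * v ^ 2 + b₄ * v ^ 4 + b₆ * v ^ 6) * Real.exp (-c * v ^ 2))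
      = fun v : ℝ ↦ b₀ * t 0 v + b₂ * t 2 v + b₄ * t 4 v + b₆ * t 6 v := by
    funext v; simp only [ht]; ring
  rw [hsplit,
    integral_add (f := fun v ↦ b₀ * t 0 v + b₂ * t 2 v + b₄ * t 4 v) (g := fun v ↦ b₆ * t 6 v)
      (((hI 0 b₀).add (hI 2 b₂)).add (hI 4 b₄)) (hI 6 b₆),
    integral_add (f := fun v ↦ b₀ * t 0 v + b₂ * t 2 v) (g := fun v ↦ b₄ * t 4 v) ((hI 0 b₀).add (hI 2 b₂)) (hI 4 b₄),
    integral_add (f := fun v ↦ b₀ * t 0 v) (g := fun v ↦ b₂ * t 2 v) (hI 0 b₀) (hI 2 b₂)]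
  simp only [ht, integral_const_mul, moment_zero, moment_two hc, moment_four hc, moment_six hc]

/-- Integrability of `(b₀ + b₂v² + b₄v⁴ + b₆v⁶) e^{−cv²}` on `(0,∞)`. [folklore] -/
private lemma integrableOn_evenPoly_mul_exp (b₀ b₂ b₄ b₆ : ℝ) {c : ℝ} (hc : 0 < c) :
    IntegrableOn (fun v : ℝ ↦ (b₀ + b₂ * v ^ 2 + b₄ * v ^ 4 + b₆ * v ^ 6) * Real.exp (-c * v ^ 2)) (Ioi 0) := by
  have hI : ∀ k : ℕ, ∀ b : ℝ, IntegrableOn (fun v : ℝ ↦ b * (v ^ k * Real.exp (-c * v ^ 2))) (Ioi 0) :=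
    fun k b ↦ (integrableOn_pow_mul_exp k hc).const_mul b
  have h : IntegrableOn (fun v : ℝ ↦ b₀ * (v ^ 0 * Real.exp (-c * v ^ 2)) + b₂ * (v ^ 2 * Real.exp (-c * v ^ 2))
      + b₄ * (v ^ 4 * Real.exp (-c * v ^ 2)) + b₆ * (v ^ 6 * Real.exp (-c * v ^ 2))) (Ioi 0) :=
    (((hI 0 b₀).add (hI 2 b₂)).add (hI 4 b₄)).add (hI 6 b₆)
  refine h.congr_fun (fun v _ ↦ ?_) measurableSet_Ioi
  simp only; ring

/-! ### The sign change of `4πv²/3 − ½` at `v₀ = √(3/(8π))` -/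

/-- `v₀ = √(3/(8π))`, the zero of `4πv²/3 − ½`. [cite: Gabcke1979, §3.1 Satz 3.1.3] -/
def kinkPt : ℝ := Real.sqrt (3 / (8 * π))

/-- The polynomial majorant of `(½ − 4πv²/3) P(πv) e^{−cv²}` on `[0, v₀]`: `e^{−cv²}` replaced by its fourth Taylor
polynomial. [cite: Gabcke1979, §3.1 Satz 3.1.3] -/
def kinkPoly (c v : ℝ) : ℝ :=
  (1 / 2 - 4 * π * v ^ 2 / 3) * (1 - (π * v) ^ 2 / 6 + 7 * (π * v) ^ 4 / 360)
    * (1 - c * v ^ 2 + (c * v ^ 2) ^ 2 / 2 - (c * v ^ 2) ^ 3 / 6 + (c * v ^ 2) ^ 4 / 24)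

/-- An antiderivative of `kinkPoly c` (odd polynomial of degree 15 in `v`). [cite: Gabcke1979, §3.1 Satz 3.1.3] -/
def kinkAnti (c v : ℝ) : ℝ :=
  let g₀ : ℝ := 1 / 2
  let g₁ : ℝ := -(4 * π / 3) - π ^ 2 / 12
  let g₂ : ℝ := 2 * π ^ 3 / 9 + 7 * π ^ 4 / 720
  let g₃ : ℝ := -(7 * π ^ 5 / 270)
  g₀ * v + (g₁ - c * g₀) * v ^ 3 / 3 + (g₂ - c * g₁ + c ^ 2 / 2 * g₀) * v ^ 5 / 5
    + (g₃ - c * g₂ + c ^ 2 / 2 * g₁ - c ^ 3 / 6 * g₀) * v ^ 7 / 7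
    + (-c * g₃ + c ^ 2 / 2 * g₂ - c ^ 3 / 6 * g₁ + c ^ 4 / 24 * g₀) * v ^ 9 / 9
    + (c ^ 2 / 2 * g₃ - c ^ 3 / 6 * g₂ + c ^ 4 / 24 * g₁) * v ^ 11 / 11
    + (-(c ^ 3 / 6) * g₃ + c ^ 4 / 24 * g₂) * v ^ 13 / 13 + (c ^ 4 / 24 * g₃) * v ^ 15 / 15

/-- The correction term `Corr(c) = ∫₀^{v₀} kinkPoly c = kinkAnti c v₀`. [cite: Gabcke1979, §3.1 Satz 3.1.3] -/
def kinkCorr (c : ℝ) : ℝ := kinkAnti c kinkPt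

/-- `kinkAnti c` has derivative `kinkPoly c`. [folklore] -/
private lemma hasDerivAt_kinkAnti (c v : ℝ) : HasDerivAt (kinkAnti c) (kinkPoly c v) v := by
  have h : HasDerivAt (kinkAnti c)
      ((1 / 2 : ℝ) * 1 + ((-(4 * π / 3) - π ^ 2 / 12) - c * (1 / 2)) * (↑(3:ℕ) * v ^ (3 - 1)) / 3
        + ((2 * π ^ 3 / 9 + 7 * π ^ 4 / 720) - c * (-(4 * π / 3) - π ^ 2 / 12) + c ^ 2 / 2 * (1 / 2)) * (↑(5:ℕ) * v ^ (5 - 1)) / 5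
        + ((-(7 * π ^ 5 / 270)) - c * (2 * π ^ 3 / 9 + 7 * π ^ 4 / 720) + c ^ 2 / 2 * (-(4 * π / 3) - π ^ 2 / 12) - c ^ 3 / 6 * (1 / 2)) * (↑(7:ℕ) * v ^ (7 - 1)) / 7
        + (-c * (-(7 * π ^ 5 / 270)) + c ^ 2 / 2 * (2 * π ^ 3 / 9 + 7 * π ^ 4 / 720) - c ^ 3 / 6 * (-(4 * π / 3) - π ^ 2 / 12) + c ^ 4 / 24 * (1 / 2)) * (↑(9:ℕ) * v ^ (9 - 1)) / 9
        + (c ^ 2 / 2 * (-(7 * π ^ 5 / 270)) - c ^ 3 / 6 * (2 * π ^ 3 / 9 + 7 * π ^ 4 / 720) + c ^ 4 / 24 * (-(4 * π / 3) - π ^ 2 / 12)) * (↑(11:ℕ) * v ^ (11 - 1)) / 11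
        + (-(c ^ 3 / 6) * (-(7 * π ^ 5 / 270)) + c ^ 4 / 24 * (2 * π ^ 3 / 9 + 7 * π ^ 4 / 720)) * (↑(13:ℕ) * v ^ (13 - 1)) / 13
        + (c ^ 4 / 24 * (-(7 * π ^ 5 / 270))) * (↑(15:ℕ) * v ^ (15 - 1)) / 15) v := by
    unfold kinkAnti
    exact (((((((((hasDerivAt_id' v).const_mul _).add (((hasDerivAt_pow 3 v).const_mul _).div_const 3)).add
      (((hasDerivAt_pow 5 v).const_mul _).div_const 5)).add (((hasDerivAt_pow 7 v).const_mul _).div_const 7)).add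
      (((hasDerivAt_pow 9 v).const_mul _).div_const 9)).add (((hasDerivAt_pow 11 v).const_mul _).div_const 11)).add
      (((hasDerivAt_pow 13 v).const_mul _).div_const 13)).add (((hasDerivAt_pow 15 v).const_mul _).div_const 15))
  refine h.congr_deriv ?_
  unfold kinkPoly
  push_cast
  ring

/-- `∫₀^{v₀} kinkPoly c = Corr(c)`. [folklore] -/
private lemma integral_kinkPoly (c : ℝ) : ∫ v in (0:ℝ)..kinkPt, kinkPoly c v = kinkCorr c := by
  rw [intervalIntegral.integral_eq_sub_of_hasDerivAt (fun v _ ↦ hasDerivAt_kinkAnti c v)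
    ((by unfold kinkPoly; fun_prop : Continuous (kinkPoly c)).intervalIntegrable _ _), kinkCorr]
  simp [kinkAnti]

/-- `v₀ > 0` and `4πv²/3 − ½ ≤ 0 ↔ v ≤ v₀` facts. [folklore] -/
private lemma kinkPt_pos : 0 < kinkPt := Real.sqrt_pos.2 (by positivity)

/-- `v₀² = 3/(8π)`. [folklore] -/
private lemma kinkPt_sq : kinkPt ^ 2 = 3 / (8 * π) := Real.sq_sqrt (by positivity)

/-- The closed form of the sign-free part: `∫₀^∞ (4πv²/3 − ½) P(πv) e^{−cv²} dv`. [cite: Gabcke1979, §3.1 Satz 3.1.3] -/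
def kinkMain (c : ℝ) : ℝ :=
  (-1 / 2 : ℝ) * (Real.sqrt (π / c) / 2) + (4 * π / 3 + π ^ 2 / 12) * (Real.sqrt (π / c) / (4 * c))
    + (-(2 * π ^ 3 / 9 + 7 * π ^ 4 / 720)) * (3 * Real.sqrt (π / c) / (8 * c ^ 2))
    + (7 * π ^ 5 / 270) * (15 * Real.sqrt (π / c) / (16 * c ^ 3))

/-- Integrability of `|4πv²/3 − ½| P(πv) e^{−cv²}` on `(0, ∞)` (dominated by a polynomial times the Gaussian).
[folklore] -/
private lemma integrableOn_abs_kink {c : ℝ} (hc : 0 < c) :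
    IntegrableOn (fun v : ℝ ↦ |4 * π * v ^ 2 / 3 - 1 / 2|
      * ((1 - (π * v) ^ 2 / 6 + 7 * (π * v) ^ 4 / 360) * Real.exp (-c * v ^ 2))) (Ioi 0) := by
  have hdom := integrableOn_evenPoly_mul_exp (1 / 2) (4 * π / 3 + π ^ 2 / 12) (2 * π ^ 3 / 9 + 7 * π ^ 4 / 720)
    (7 * π ^ 5 / 270) hc
  refine Integrable.mono' hdom ?_ ?_
  · have : Continuous (fun v : ℝ ↦ |4 * π * v ^ 2 / 3 - 1 / 2|
        * ((1 - (π * v) ^ 2 / 6 + 7 * (π * v) ^ 4 / 360) * Real.exp (-c * v ^ 2))) := by fun_prop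
    exact this.aestronglyMeasurable
  · refine (ae_restrict_iff' measurableSet_Ioi).2 (ae_of_all _ fun v (_ : 0 < v) ↦ ?_)
    have hw_nn : 0 ≤ (1 - (π * v) ^ 2 / 6 + 7 * (π * v) ^ 4 / 360) * Real.exp (-c * v ^ 2) :=
      mul_nonneg (sinhPoly_pos (π * v)).le (Real.exp_pos _).le
    rw [Real.norm_eq_abs, abs_mul, abs_abs, abs_of_nonneg hw_nn]
    have habs : |4 * π * v ^ 2 / 3 - 1 / 2| ≤ 1 / 2 + 4 * π * v ^ 2 / 3 := by
      refine abs_le.2 ⟨?_, ?_⟩ <;> nlinarith [sq_nonneg v, Real.pi_pos]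
    have hP2 : (1 - (π * v) ^ 2 / 6 + 7 * (π * v) ^ 4 / 360) ≤ 1 + (π * v) ^ 2 / 6 + 7 * (π * v) ^ 4 / 360 := by
      nlinarith [sq_nonneg (π * v)]
    calc |4 * π * v ^ 2 / 3 - 1 / 2| * ((1 - (π * v) ^ 2 / 6 + 7 * (π * v) ^ 4 / 360) * Real.exp (-c * v ^ 2))
        ≤ (1 / 2 + 4 * π * v ^ 2 / 3) * ((1 - (π * v) ^ 2 / 6 + 7 * (π * v) ^ 4 / 360) * Real.exp (-c * v ^ 2)) :=
          mul_le_mul_of_nonneg_right habs hw_nn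
      _ ≤ (1 / 2 + 4 * π * v ^ 2 / 3) * ((1 + (π * v) ^ 2 / 6 + 7 * (π * v) ^ 4 / 360) * Real.exp (-c * v ^ 2)) :=
          mul_le_mul_of_nonneg_left (mul_le_mul_of_nonneg_right hP2 (Real.exp_pos _).le) (by positivity)
      _ = _ := by ring

/-- **The leading-term integral with the sign change kept**: for `c > 0`,
`∫₀^∞ |4πv²/3 − ½| P(πv) e^{−cv²} dv ≤ kinkMain c + 2 Corr(c)`. [cite: Gabcke1979, §3.1 Satz 3.1.3] -/
theorem integral_abs_kink_le {c : ℝ} (hc : 0 < c) :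
    ∫ v in Ioi (0:ℝ), |4 * π * v ^ 2 / 3 - 1 / 2| * ((1 - (π * v) ^ 2 / 6 + 7 * (π * v) ^ 4 / 360) * Real.exp (-c * v ^ 2))
      ≤ kinkMain c + 2 * kinkCorr c := by
  set f : ℝ → ℝ := fun v ↦ 4 * π * v ^ 2 / 3 - 1 / 2 with hf
  set w : ℝ → ℝ := fun v ↦ (1 - (π * v) ^ 2 / 6 + 7 * (π * v) ^ 4 / 360) * Real.exp (-c * v ^ 2) with hw
  have hw_nn : ∀ v, 0 ≤ w v := fun v ↦ mul_nonneg (sinhPoly_pos (π * v)).le (Real.exp_pos _).le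
  have hP : ∀ v : ℝ, (1 - (π * v) ^ 2 / 6 + 7 * (π * v) ^ 4 / 360) = 1 + (-(π ^ 2 / 6)) * v ^ 2 + (7 * π ^ 4 / 360) * v ^ 4 + 0 * v ^ 6 := by
    intro v; ring
  -- integrability of `f w` and `|f| w` on `(0, ∞)`
  have hfw_eq : ∀ v, f v * w v = ((-1 / 2 : ℝ) + (4 * π / 3 + π ^ 2 / 12) * v ^ 2 + (-(2 * π ^ 3 / 9 + 7 * π ^ 4 / 720)) * v ^ 4
      + (7 * π ^ 5 / 270) * v ^ 6) * Real.exp (-c * v ^ 2) := by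
    intro v; simp only [hf, hw]; ring
  have hI_fw : IntegrableOn (fun v ↦ f v * w v) (Ioi 0) := by
    have := integrableOn_evenPoly_mul_exp (-1 / 2) (4 * π / 3 + π ^ 2 / 12) (-(2 * π ^ 3 / 9 + 7 * π ^ 4 / 720))
      (7 * π ^ 5 / 270) hc
    exact this.congr_fun (fun v _ ↦ (hfw_eq v).symm) measurableSet_Ioi
  have hI_abs : IntegrableOn (fun v ↦ |f v| * w v) (Ioi 0) := by
    simpa only [hf, hw] using integrableOn_abs_kink hc
  -- split `(0, ∞) = (0, v₀] ∪ (v₀, ∞)`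
  have hv0 := kinkPt_pos
  have hunion : Ioi (0:ℝ) = Ioc 0 kinkPt ∪ Ioi kinkPt := (Ioc_union_Ioi_eq_Ioi hv0.le).symm
  have hdisj : Disjoint (Ioc (0:ℝ) kinkPt) (Ioi kinkPt) := Ioc_disjoint_Ioi_same
  have hsplit : ∀ g : ℝ → ℝ, IntegrableOn g (Ioi 0) →
      ∫ v in Ioi 0, g v = (∫ v in Ioc 0 kinkPt, g v) + ∫ v in Ioi kinkPt, g v := by
    intro g hg
    rw [hunion, setIntegral_union hdisj measurableSet_Ioi (hg.mono_set Ioc_subset_Ioi_self)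
      (hg.mono_set (Ioi_subset_Ioi hv0.le))]
  -- sign of `f`
  have hsign : ∀ v, 0 ≤ v → (f v ≤ 0 ↔ v ≤ kinkPt) := by
    intro v hv
    have e : f v = 4 * π / 3 * (v ^ 2 - kinkPt ^ 2) := by rw [hf, kinkPt_sq]; field_simp; ring
    rw [e]
    constructor
    · intro h
      have : v ^ 2 ≤ kinkPt ^ 2 := by nlinarith [Real.pi_pos]
      exact (pow_le_pow_iff_left₀ hv hv0.le two_ne_zero).1 this
    · intro h
      have : v ^ 2 ≤ kinkPt ^ 2 := pow_le_pow_left₀ hv h 2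
      nlinarith [Real.pi_pos]
  have h1 : ∫ v in Ioi kinkPt, |f v| * w v = ∫ v in Ioi kinkPt, f v * w v := by
    refine setIntegral_congr_fun measurableSet_Ioi fun v (hv : kinkPt < v) ↦ ?_
    have : 0 ≤ f v := (not_le.1 (mt (hsign v (hv0.le.trans hv.le)).1 (not_le.2 hv))).le
    rw [abs_of_nonneg this]
  have h2 : ∫ v in Ioc 0 kinkPt, |f v| * w v = ∫ v in Ioc 0 kinkPt, (-f v) * w v := by
    refine setIntegral_congr_fun measurableSet_Ioc fun v hv ↦ ?_
    rw [abs_of_nonpos ((hsign v hv.1.le).2 hv.2)]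
  -- the correction integral
  have hcorr : ∫ v in Ioc 0 kinkPt, (-f v) * w v ≤ kinkCorr c := by
    have hle : ∫ v in Ioc 0 kinkPt, (-f v) * w v ≤ ∫ v in Ioc 0 kinkPt, kinkPoly c v := by
      refine setIntegral_mono_on ((hI_abs.mono_set Ioc_subset_Ioi_self).congr_fun (fun v hv ↦ by
          show |f v| * w v = -f v * w v; rw [abs_of_nonpos ((hsign v hv.1.le).2 hv.2)]) measurableSet_Ioc)
        ((by unfold kinkPoly; fun_prop : Continuous (kinkPoly c)).integrableOn_Ioc) measurableSet_Ioc
        fun v hv ↦ ?_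
      have hfneg : 0 ≤ -f v := by linarith [(hsign v hv.1.le).2 hv.2]
      have hT := exp_neg_le_taylor4 (show 0 ≤ c * v ^ 2 by positivity)
      rw [kinkPoly, hw]
      have e : -f v = 1 / 2 - 4 * π * v ^ 2 / 3 := by simp only [hf]; ring
      rw [← e, mul_assoc]
      refine mul_le_mul_of_nonneg_left ?_ hfneg
      refine mul_le_mul_of_nonneg_left ?_ (sinhPoly_pos (π * v)).le
      rw [show -c * v ^ 2 = -(c * v ^ 2) by ring]
      refine hT.trans (le_of_eq ?_); ring
    rw [← integral_kinkPoly, intervalIntegral.integral_of_le hv0.le]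
    exact hle
  -- assemble
  have hmain : ∫ v in Ioi 0, f v * w v = kinkMain c := by
    rw [show (fun v ↦ f v * w v) = fun v ↦ ((-1 / 2 : ℝ) + (4 * π / 3 + π ^ 2 / 12) * v ^ 2
        + (-(2 * π ^ 3 / 9 + 7 * π ^ 4 / 720)) * v ^ 4 + (7 * π ^ 5 / 270) * v ^ 6) * Real.exp (-c * v ^ 2) from
        funext hfw_eq, integral_evenPoly_mul_exp _ _ _ _ hc, kinkMain]
  have hA := hsplit _ hI_abs
  have hB := hsplit _ hI_fw
  rw [hA, h1, h2]
  have : ∫ v in Ioc 0 kinkPt, (-f v) * w v = -∫ v in Ioc 0 kinkPt, f v * w v := by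
    rw [← integral_neg]; congr 1; funext v; ring
  linarith [hmain, hcorr, this]

/-! ### The sharp majorants and their integrals -/

/-- The non-leading part of `B(a,v)/v`: `P_rest(a, v) = v/(2a²) + (2+√2)√2 v²/(3a³) + 2πv³/a² + (2+√2)√2(8π/5) v⁴/a³`
(written with zero coefficients for `v⁰`, `v⁵`). [cite: Gabcke1979, §3.1 Satz 3.1.3] -/
def polyRest (a v : ℝ) : ℝ :=
  0 + 1 / (2 * a ^ 2) * v + (2 + Real.sqrt 2) * Real.sqrt 2 / (3 * a ^ 3) * v ^ 2 + 2 * π / a ^ 2 * v ^ 3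
    + (2 + Real.sqrt 2) * Real.sqrt 2 * (8 * π / 5) / a ^ 3 * v ^ 4 + 0 * v ^ 5

/-- `B(a, v) = v · ((√2/a)|4πv²/3 − ½| + P_rest(a, v))` for `v ≥ 0`. [cite: Gabcke1979, §3.1 Satz 3.1.2] -/
private lemma gBound_eq_sharp {a v : ℝ} (ha : 0 < a) (hv : 0 ≤ v) :
    gBound a v = v * (Real.sqrt 2 / a * |4 * π * v ^ 2 / 3 - 1 / 2| + polyRest a v) := by
  have hv3 : |v| ^ 3 = v ^ 3 := by rw [abs_of_nonneg hv]
  have hv5 : |v| ^ 5 = v ^ 5 := by rw [abs_of_nonneg hv]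
  have habs : |4 * π * v ^ 3 / 3 - v / 2| = v * |4 * π * v ^ 2 / 3 - 1 / 2| := by
    rw [show 4 * π * v ^ 3 / 3 - v / 2 = v * (4 * π * v ^ 2 / 3 - 1 / 2) by ring, abs_mul, abs_of_nonneg hv]
  rw [gBound, hv3, hv5, habs, polyRest]
  field_simp
  ring

/-- `P_rest ≥ 0` for `v ≥ 0`. [folklore] -/
private lemma polyRest_nonneg {a v : ℝ} (ha : 0 < a) (hv : 0 ≤ v) : 0 ≤ polyRest a v := by
  unfold polyRest; positivity

/-- **Sharp majorant on the positive half-line**: for `a > 0`, `v > 0`,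
`|k(a,v) − k₀(a,v)| ≤ (√2/a)|4πv²/3 − ½| P(πv) e^{−(10π/3)v²}/(2π) + P_rest(a,v) e^{−(10π/3)v²}/(2π) + far`.
[cite: Gabcke1979, §3.1 Satz 3.1.3] -/
theorem norm_rsKer_sub_le_pos_sharp {a v : ℝ} (ha : 0 < a) (hv : 0 < v) :
    ‖rsKer a v - rsKer0 a v‖ ≤
      Real.sqrt 2 / (2 * π * a) * (|4 * π * v ^ 2 / 3 - 1 / 2|
          * ((1 - (π * v) ^ 2 / 6 + 7 * (π * v) ^ 4 / 360) * Real.exp (-(10 * π / 3) * v ^ 2)))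
      + 1 / (2 * π) * (polyRest a v * Real.exp (-(10 * π / 3) * v ^ 2))
      + farFactor a * (Real.exp (Real.log 2 / 4) * Real.exp (-π * v ^ 2) + Real.exp (-4 * π * v ^ 2)) := by
  have h0 := norm_rsKer_sub_rsKer0_le a hv.ne'
  rw [abs_of_pos hv] at h0
  have hsinh : 0 < Real.sinh (π * v) := Real.sinh_pos_iff.2 (by positivity)
  have hPv := sinhPoly_pos (π * v)
  set A : ℝ := Real.sqrt 2 / a * |4 * π * v ^ 2 / 3 - 1 / 2| with hA
  have hA0 : 0 ≤ A := by positivity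
  have hR0 := polyRest_nonneg ha hv.le
  have hterm1_nn : 0 ≤ Real.sqrt 2 / (2 * π * a) * (|4 * π * v ^ 2 / 3 - 1 / 2|
      * ((1 - (π * v) ^ 2 / 6 + 7 * (π * v) ^ 4 / 360) * Real.exp (-(10 * π / 3) * v ^ 2))) := by positivity
  have hterm2_nn : 0 ≤ 1 / (2 * π) * (polyRest a v * Real.exp (-(10 * π / 3) * v ^ 2)) := by positivity
  have hfar_nn : 0 ≤ farFactor a * (Real.exp (Real.log 2 / 4) * Real.exp (-π * v ^ 2) + Real.exp (-4 * π * v ^ 2)) :=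
    mul_nonneg (farFactor_nonneg ha) (by positivity)
  rcases le_or_gt v (a / 2) with hva | hva
  · have h1 := norm_gTilde_sub_one_le_of_nonneg ha hv.le hva
    rw [gBound_eq_sharp ha hv.le] at h1
    -- `φ ≤ v (A + R) e / (2 sinh πv) = (vA e)(1/(2 sinh)) + (vR e)(1/(2 sinh))`
    have h2 : Real.exp (-4 * π * v ^ 2) * ‖gTilde a v - 1‖ / (2 * Real.sinh (π * v))
        ≤ v * (A + polyRest a v) * Real.exp (-(10 * π / 3) * v ^ 2) * (1 / (2 * Real.sinh (π * v))) := by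
      rw [← div_eq_mul_one_div]
      exact div_le_div_of_nonneg_right h1 (by positivity)
    have hS1 := one_div_two_sinh_le_poly (show 0 < π * v by positivity)
    have hS2 : 1 / (2 * Real.sinh (π * v)) ≤ 1 / (2 * (π * v)) :=
      one_div_le_one_div_of_le (by positivity) (mul_le_mul_of_nonneg_left (Real.self_le_sinh_iff.2 (by positivity)) (by norm_num))
    have h3 : v * (A + polyRest a v) * Real.exp (-(10 * π / 3) * v ^ 2) * (1 / (2 * Real.sinh (π * v)))
        ≤ v * A * Real.exp (-(10 * π / 3) * v ^ 2) * ((1 - (π * v) ^ 2 / 6 + 7 * (π * v) ^ 4 / 360) / (2 * (π * v)))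
          + v * polyRest a v * Real.exp (-(10 * π / 3) * v ^ 2) * (1 / (2 * (π * v))) := by
      have e : v * (A + polyRest a v) * Real.exp (-(10 * π / 3) * v ^ 2) * (1 / (2 * Real.sinh (π * v)))
          = v * A * Real.exp (-(10 * π / 3) * v ^ 2) * (1 / (2 * Real.sinh (π * v)))
            + v * polyRest a v * Real.exp (-(10 * π / 3) * v ^ 2) * (1 / (2 * Real.sinh (π * v))) := by ring
      rw [e]
      exact add_le_add (mul_le_mul_of_nonneg_left hS1 (by positivity)) (mul_le_mul_of_nonneg_left hS2 (by positivity))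
    have h4 : v * A * Real.exp (-(10 * π / 3) * v ^ 2) * ((1 - (π * v) ^ 2 / 6 + 7 * (π * v) ^ 4 / 360) / (2 * (π * v)))
          + v * polyRest a v * Real.exp (-(10 * π / 3) * v ^ 2) * (1 / (2 * (π * v)))
        = Real.sqrt 2 / (2 * π * a) * (|4 * π * v ^ 2 / 3 - 1 / 2|
            * ((1 - (π * v) ^ 2 / 6 + 7 * (π * v) ^ 4 / 360) * Real.exp (-(10 * π / 3) * v ^ 2)))
          + 1 / (2 * π) * (polyRest a v * Real.exp (-(10 * π / 3) * v ^ 2)) := by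
      rw [hA]; field_simp
    linarith
  · have h1 := norm_gTilde_sub_one_le_far (u := v) ha
    have h2 : Real.exp (-4 * π * v ^ 2) * ‖gTilde a v - 1‖ / (2 * Real.sinh (π * v))
        ≤ (Real.exp (Real.log 2 / 4) * Real.exp (-π * v ^ 2) + Real.exp (-4 * π * v ^ 2))
          * (1 / (2 * Real.sinh (π * v))) := by
      rw [← mul_one_div (Real.exp (-4 * π * v ^ 2) * ‖gTilde a v - 1‖)]
      exact mul_le_mul_of_nonneg_right h1 (by positivity)
    have h3 := one_div_sinh_mono ha hva.le
    have h4 : (Real.exp (Real.log 2 / 4) * Real.exp (-π * v ^ 2) + Real.exp (-4 * π * v ^ 2))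
          * (1 / (2 * Real.sinh (π * v)))
        ≤ farFactor a * (Real.exp (Real.log 2 / 4) * Real.exp (-π * v ^ 2) + Real.exp (-4 * π * v ^ 2)) := by
      rw [farFactor, mul_comm]
      exact mul_le_mul_of_nonneg_right h3 (by positivity)
    linarith

/-- **Sharp majorant on the negative half-line**: for `a > 0`, `v > 0`,
`|k(a,−v) − k₀(a,−v)| ≤ (√2/a)|4πv²/3 − ½| P(πv) e^{−4πv²}/(2π) + P_rest e^{−4πv²}/(2π) + v P₊(a,v) e^{−4πv²}/(2πa) + far`.
[cite: Gabcke1979, §3.1 Satz 3.1.3] -/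
theorem norm_rsKer_sub_le_neg_sharp {a v : ℝ} (ha : 0 < a) (hv : 0 < v) :
    ‖rsKer a (-v) - rsKer0 a (-v)‖ ≤
      Real.sqrt 2 / (2 * π * a) * (|4 * π * v ^ 2 / 3 - 1 / 2|
          * ((1 - (π * v) ^ 2 / 6 + 7 * (π * v) ^ 4 / 360) * Real.exp (-(4 * π) * v ^ 2)))
      + 1 / (2 * π) * (polyRest a v * Real.exp (-(4 * π) * v ^ 2))
      + 1 / (2 * π * a) * ((v * polyPos a v) * Real.exp (-(4 * π) * v ^ 2))
      + farFactor a * (Real.exp (Real.log 2 / 4) * Real.exp (-π * v ^ 2) + Real.exp (-4 * π * v ^ 2)) := by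
  simp only [show (-(4 * π) : ℝ) * v ^ 2 = -4 * π * v ^ 2 from by ring]
  have h0 := norm_rsKer_sub_rsKer0_le a (u := -v) (by linarith)
  rw [abs_neg, abs_of_pos hv, show (-v) ^ 2 = v ^ 2 by ring] at h0
  have hsinh : 0 < Real.sinh (π * v) := Real.sinh_pos_iff.2 (by positivity)
  have hPv := sinhPoly_pos (π * v)
  set A : ℝ := Real.sqrt 2 / a * |4 * π * v ^ 2 / 3 - 1 / 2| with hA
  have hA0 : 0 ≤ A := by positivity
  have hR0 := polyRest_nonneg ha hv.le
  have hP0 : 0 ≤ polyPos a v := by unfold polyPos; positivity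
  have hterm1_nn : 0 ≤ Real.sqrt 2 / (2 * π * a) * (|4 * π * v ^ 2 / 3 - 1 / 2|
      * ((1 - (π * v) ^ 2 / 6 + 7 * (π * v) ^ 4 / 360) * Real.exp (-4 * π * v ^ 2))) := by positivity
  have hterm2_nn : 0 ≤ 1 / (2 * π) * (polyRest a v * Real.exp (-4 * π * v ^ 2)) := by positivity
  have hterm3_nn : 0 ≤ 1 / (2 * π * a) * ((v * polyPos a v) * Real.exp (-4 * π * v ^ 2)) := by positivity
  have hfar_nn : 0 ≤ farFactor a * (Real.exp (Real.log 2 / 4) * Real.exp (-π * v ^ 2) + Real.exp (-4 * π * v ^ 2)) :=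
    mul_nonneg (farFactor_nonneg ha) (by positivity)
  rcases le_or_gt v (a / 2) with hva | hva
  · have h1 := norm_gTilde_sub_one_le_of_nonpos ha (u := -v) (by linarith) (by linarith)
    rw [show (-v) ^ 2 = v ^ 2 by ring, abs_neg, abs_of_pos hv, gBound_neg] at h1
    have hB := gBound_le_mul_polyPos ha hv.le
    have hBeq := gBound_eq_sharp ha hv.le
    -- `gB (1 + v/a) = gB + (v/a) gB ≤ v(A + R) + (v/a) v P₊`
    have hB2 : gBound a v * (1 + v / a) ≤ v * (A + polyRest a v) + v / a * (v * polyPos a v) := by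
      rw [mul_add, mul_one, ← hBeq]
      have : gBound a v * (v / a) ≤ v / a * (v * polyPos a v) := by
        rw [mul_comm]; exact mul_le_mul_of_nonneg_left hB (by positivity)
      linarith
    have h2 : Real.exp (-4 * π * v ^ 2) * ‖gTilde a (-v) - 1‖ / (2 * Real.sinh (π * v))
        ≤ (v * (A + polyRest a v) + v / a * (v * polyPos a v)) * Real.exp (-4 * π * v ^ 2)
          * (1 / (2 * Real.sinh (π * v))) := by
      rw [← div_eq_mul_one_div]
      refine div_le_div_of_nonneg_right (h1.trans ?_) (by positivity)
      exact mul_le_mul_of_nonneg_right hB2 (Real.exp_pos _).le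
    have hS1 := one_div_two_sinh_le_poly (show 0 < π * v by positivity)
    have hS2 : 1 / (2 * Real.sinh (π * v)) ≤ 1 / (2 * (π * v)) :=
      one_div_le_one_div_of_le (by positivity) (mul_le_mul_of_nonneg_left (Real.self_le_sinh_iff.2 (by positivity)) (by norm_num))
    have h3 : (v * (A + polyRest a v) + v / a * (v * polyPos a v)) * Real.exp (-4 * π * v ^ 2)
          * (1 / (2 * Real.sinh (π * v)))
        ≤ v * A * Real.exp (-4 * π * v ^ 2) * ((1 - (π * v) ^ 2 / 6 + 7 * (π * v) ^ 4 / 360) / (2 * (π * v)))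
          + (v * polyRest a v + v / a * (v * polyPos a v)) * Real.exp (-4 * π * v ^ 2) * (1 / (2 * (π * v))) := by
      have e : (v * (A + polyRest a v) + v / a * (v * polyPos a v)) * Real.exp (-4 * π * v ^ 2)
          * (1 / (2 * Real.sinh (π * v)))
          = v * A * Real.exp (-4 * π * v ^ 2) * (1 / (2 * Real.sinh (π * v)))
            + (v * polyRest a v + v / a * (v * polyPos a v)) * Real.exp (-4 * π * v ^ 2)
              * (1 / (2 * Real.sinh (π * v))) := by ring
      rw [e]
      exact add_le_add (mul_le_mul_of_nonneg_left hS1 (by positivity)) (mul_le_mul_of_nonneg_left hS2 (by positivity))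
    have h4 : v * A * Real.exp (-4 * π * v ^ 2) * ((1 - (π * v) ^ 2 / 6 + 7 * (π * v) ^ 4 / 360) / (2 * (π * v)))
          + (v * polyRest a v + v / a * (v * polyPos a v)) * Real.exp (-4 * π * v ^ 2) * (1 / (2 * (π * v)))
        = Real.sqrt 2 / (2 * π * a) * (|4 * π * v ^ 2 / 3 - 1 / 2|
            * ((1 - (π * v) ^ 2 / 6 + 7 * (π * v) ^ 4 / 360) * Real.exp (-4 * π * v ^ 2)))
          + 1 / (2 * π) * (polyRest a v * Real.exp (-4 * π * v ^ 2))
          + 1 / (2 * π * a) * ((v * polyPos a v) * Real.exp (-4 * π * v ^ 2)) := by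
      rw [hA]; field_simp; ring
    linarith
  · have h1 := norm_gTilde_sub_one_le_far (u := -v) ha
    rw [show (-v) ^ 2 = v ^ 2 by ring] at h1
    have h2 : Real.exp (-4 * π * v ^ 2) * ‖gTilde a (-v) - 1‖ / (2 * Real.sinh (π * v))
        ≤ (Real.exp (Real.log 2 / 4) * Real.exp (-π * v ^ 2) + Real.exp (-4 * π * v ^ 2))
          * (1 / (2 * Real.sinh (π * v))) := by
      rw [← mul_one_div (Real.exp (-4 * π * v ^ 2) * ‖gTilde a (-v) - 1‖)]
      exact mul_le_mul_of_nonneg_right h1 (by positivity)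
    have h3 := one_div_sinh_mono ha hva.le
    have h4 : (Real.exp (Real.log 2 / 4) * Real.exp (-π * v ^ 2) + Real.exp (-4 * π * v ^ 2))
          * (1 / (2 * Real.sinh (π * v)))
        ≤ farFactor a * (Real.exp (Real.log 2 / 4) * Real.exp (-π * v ^ 2) + Real.exp (-4 * π * v ^ 2)) := by
      rw [farFactor, mul_comm]
      exact mul_le_mul_of_nonneg_right h3 (by positivity)
    linarith

/-- The sharp closed-form bound `S♯(a)` for `∫ |k − k₀|` (far factor in elementary form).
[cite: Gabcke1979, §3.1 Satz 3.1.3] -/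
def kerIntegralBoundSharp (a : ℝ) : ℝ :=
  Real.sqrt 2 / (2 * π * a) * (kinkMain (10 * π / 3) + 2 * kinkCorr (10 * π / 3))
  + 1 / (2 * π) * (0 * (Real.sqrt (3 / 10) / 2) + 1 / (2 * a ^ 2) * (1 / (2 * (10 * π / 3)))
      + (2 + Real.sqrt 2) * Real.sqrt 2 / (3 * a ^ 3) * (Real.sqrt (3 / 10) / (4 * (10 * π / 3)))
      + 2 * π / a ^ 2 * (1 / (2 * (10 * π / 3) ^ 2))
      + (2 + Real.sqrt 2) * Real.sqrt 2 * (8 * π / 5) / a ^ 3 * (3 * Real.sqrt (3 / 10) / (8 * (10 * π / 3) ^ 2))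
      + 0 * (1 / (10 * π / 3) ^ 3))
  + Real.sqrt 2 / (2 * π * a) * (kinkMain (4 * π) + 2 * kinkCorr (4 * π))
  + 1 / (2 * π) * (0 * ((1 / 2) / 2) + 1 / (2 * a ^ 2) * (1 / (2 * (4 * π)))
      + (2 + Real.sqrt 2) * Real.sqrt 2 / (3 * a ^ 3) * ((1 / 2) / (4 * (4 * π)))
      + 2 * π / a ^ 2 * (1 / (2 * (4 * π) ^ 2))
      + (2 + Real.sqrt 2) * Real.sqrt 2 * (8 * π / 5) / a ^ 3 * (3 * (1 / 2) / (8 * (4 * π) ^ 2))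
      + 0 * (1 / (4 * π) ^ 3))
  + 1 / (2 * π * a) * (0 * ((1 / 2) / 2) + Real.sqrt 2 / (2 * a) * (1 / (2 * (4 * π)))
      + 1 / (2 * a ^ 2) * ((1 / 2) / (4 * (4 * π)))
      + (4 * Real.sqrt 2 * π / (3 * a) + (2 + Real.sqrt 2) * Real.sqrt 2 / (3 * a ^ 3)) * (1 / (2 * (4 * π) ^ 2))
      + 2 * π / a ^ 2 * (3 * (1 / 2) / (8 * (4 * π) ^ 2))
      + (2 + Real.sqrt 2) * Real.sqrt 2 * (8 * π / 5) / a ^ 3 * (1 / (4 * π) ^ 3))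
  + 2 * (3840 / (π ^ 5 * a ^ 5) * (Real.exp (Real.log 2 / 4) / 2 + 1 / 4))

/-- **`∫ |k − k₀| ≤ S♯(a)`** for a non-integer `a > 0` (sharp integration). [cite: Gabcke1979, §3.1 Satz 3.1.3] -/
theorem integral_norm_rsKer_sub_le_sharp {a : ℝ} (ha : 0 < a) (hai : ∀ n : ℤ, (n : ℝ) ≠ a) :
    ∫ u : ℝ, ‖rsKer a u - rsKer0 a u‖ ≤ kerIntegralBoundSharp a := by
  set φ : ℝ → ℝ := fun u ↦ ‖rsKer a u - rsKer0 a u‖ with hφ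
  have hint : Integrable φ := ((integrable_rsKer ha hai).sub (integrable_rsKer0 hai)).norm
  have hsplit : ∫ u : ℝ, φ u = (∫ v in Ioi (0:ℝ), φ v) + ∫ v in Ioi (0:ℝ), φ (-v) := by
    rw [← integral_add_compl (measurableSet_Ioi (a := (0:ℝ))) hint, compl_Ioi, integral_comp_neg_Ioi, neg_zero]
  have hcp : (0:ℝ) < 10 * π / 3 := by positivity
  have hcm : (0:ℝ) < 4 * π := by positivity
  -- the pieces and their integrability / integrals
  set Kp : ℝ → ℝ := fun v ↦ |4 * π * v ^ 2 / 3 - 1 / 2|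
      * ((1 - (π * v) ^ 2 / 6 + 7 * (π * v) ^ 4 / 360) * Real.exp (-(10 * π / 3) * v ^ 2)) with hKp
  set Km : ℝ → ℝ := fun v ↦ |4 * π * v ^ 2 / 3 - 1 / 2|
      * ((1 - (π * v) ^ 2 / 6 + 7 * (π * v) ^ 4 / 360) * Real.exp (-(4 * π) * v ^ 2)) with hKm
  set Rp : ℝ → ℝ := fun v ↦ polyRest a v * Real.exp (-(10 * π / 3) * v ^ 2) with hRp
  set Rm : ℝ → ℝ := fun v ↦ polyRest a v * Real.exp (-(4 * π) * v ^ 2) with hRm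
  set Qm : ℝ → ℝ := fun v ↦ (v * polyPos a v) * Real.exp (-(4 * π) * v ^ 2) with hQm
  set Fr : ℝ → ℝ := fun v ↦ farFactor a * (Real.exp (Real.log 2 / 4) * Real.exp (-π * v ^ 2)
      + Real.exp (-4 * π * v ^ 2)) with hFr
  have hIKp : IntegrableOn Kp (Ioi 0) := integrableOn_abs_kink hcp
  have hIKm : IntegrableOn Km (Ioi 0) := integrableOn_abs_kink hcm
  have hRest : ∀ {c : ℝ}, 0 < c → (fun v ↦ polyRest a v * Real.exp (-c * v ^ 2))
      = fun v ↦ (0 + 1 / (2 * a ^ 2) * v + (2 + Real.sqrt 2) * Real.sqrt 2 / (3 * a ^ 3) * v ^ 2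
        + 2 * π / a ^ 2 * v ^ 3 + (2 + Real.sqrt 2) * Real.sqrt 2 * (8 * π / 5) / a ^ 3 * v ^ 4 + 0 * v ^ 5)
        * Real.exp (-c * v ^ 2) := fun _ ↦ by funext v; rw [polyRest]
  have hQ : (fun v ↦ (v * polyPos a v) * Real.exp (-(4 * π) * v ^ 2))
      = fun v ↦ (0 + Real.sqrt 2 / (2 * a) * v + 1 / (2 * a ^ 2) * v ^ 2
        + (4 * Real.sqrt 2 * π / (3 * a) + (2 + Real.sqrt 2) * Real.sqrt 2 / (3 * a ^ 3)) * v ^ 3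
        + 2 * π / a ^ 2 * v ^ 4 + (2 + Real.sqrt 2) * Real.sqrt 2 * (8 * π / 5) / a ^ 3 * v ^ 5)
        * Real.exp (-(4 * π) * v ^ 2) := by funext v; rw [polyPos]; ring
  have hIRp : IntegrableOn Rp (Ioi 0) := by rw [hRp, hRest hcp]; exact integrableOn_poly_mul_exp _ _ _ _ _ _ hcp
  have hIRm : IntegrableOn Rm (Ioi 0) := by rw [hRm, hRest hcm]; exact integrableOn_poly_mul_exp _ _ _ _ _ _ hcm
  have hIQm : IntegrableOn Qm (Ioi 0) := by rw [hQm, hQ]; exact integrableOn_poly_mul_exp _ _ _ _ _ _ hcm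
  have hIFr : IntegrableOn Fr (Ioi 0) := integrableOn_far a
  -- majorants as combinations
  have hMp : ∀ v ∈ Ioi (0:ℝ), φ v ≤ (Real.sqrt 2 / (2 * π * a) * Kp v + 1 / (2 * π) * Rp v) + Fr v :=
    fun v hv ↦ by simpa only [hKp, hRp, hFr, add_assoc] using norm_rsKer_sub_le_pos_sharp ha hv
  have hMm : ∀ v ∈ Ioi (0:ℝ), φ (-v) ≤ (Real.sqrt 2 / (2 * π * a) * Km v + 1 / (2 * π) * Rm v
      + 1 / (2 * π * a) * Qm v) + Fr v :=
    fun v hv ↦ by simpa only [hKm, hRm, hQm, hFr, add_assoc] using norm_rsKer_sub_le_neg_sharp ha hv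
  have hle1 : ∫ v in Ioi (0:ℝ), φ v
      ≤ ∫ v in Ioi (0:ℝ), ((Real.sqrt 2 / (2 * π * a) * Kp v + 1 / (2 * π) * Rp v) + Fr v) :=
    setIntegral_mono_on hint.integrableOn (((hIKp.const_mul _).add (hIRp.const_mul _)).add hIFr)
      measurableSet_Ioi hMp
  have hle2 : ∫ v in Ioi (0:ℝ), φ (-v)
      ≤ ∫ v in Ioi (0:ℝ), ((Real.sqrt 2 / (2 * π * a) * Km v + 1 / (2 * π) * Rm v + 1 / (2 * π * a) * Qm v) + Fr v) :=
    setIntegral_mono_on (hint.comp_neg.integrableOn)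
      ((((hIKm.const_mul _).add (hIRm.const_mul _)).add (hIQm.const_mul _)).add hIFr) measurableSet_Ioi hMm
  -- evaluate
  have hv1 : ∫ v in Ioi (0:ℝ), ((Real.sqrt 2 / (2 * π * a) * Kp v + 1 / (2 * π) * Rp v) + Fr v)
      = Real.sqrt 2 / (2 * π * a) * (∫ v in Ioi (0:ℝ), Kp v) + 1 / (2 * π) * (∫ v in Ioi (0:ℝ), Rp v)
        + ∫ v in Ioi (0:ℝ), Fr v := by
    rw [integral_add (f := fun v ↦ Real.sqrt 2 / (2 * π * a) * Kp v + 1 / (2 * π) * Rp v) (g := Fr)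
        ((hIKp.const_mul _).add (hIRp.const_mul _)) hIFr,
      integral_add (hIKp.const_mul _) (hIRp.const_mul _), integral_const_mul, integral_const_mul]
  have hv2 : ∫ v in Ioi (0:ℝ), ((Real.sqrt 2 / (2 * π * a) * Km v + 1 / (2 * π) * Rm v + 1 / (2 * π * a) * Qm v) + Fr v)
      = Real.sqrt 2 / (2 * π * a) * (∫ v in Ioi (0:ℝ), Km v) + 1 / (2 * π) * (∫ v in Ioi (0:ℝ), Rm v)
        + 1 / (2 * π * a) * (∫ v in Ioi (0:ℝ), Qm v) + ∫ v in Ioi (0:ℝ), Fr v := by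
    rw [integral_add (f := fun v ↦ Real.sqrt 2 / (2 * π * a) * Km v + 1 / (2 * π) * Rm v + 1 / (2 * π * a) * Qm v)
        (g := Fr) (((hIKm.const_mul _).add (hIRm.const_mul _)).add (hIQm.const_mul _)) hIFr,
      integral_add (f := fun v ↦ Real.sqrt 2 / (2 * π * a) * Km v + 1 / (2 * π) * Rm v)
        (g := fun v ↦ 1 / (2 * π * a) * Qm v) ((hIKm.const_mul _).add (hIRm.const_mul _)) (hIQm.const_mul _),
      integral_add (hIKm.const_mul _) (hIRm.const_mul _), integral_const_mul, integral_const_mul, integral_const_mul]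
  have hKp_le : ∫ v in Ioi (0:ℝ), Kp v ≤ kinkMain (10 * π / 3) + 2 * kinkCorr (10 * π / 3) := integral_abs_kink_le hcp
  have hKm_le : ∫ v in Ioi (0:ℝ), Km v ≤ kinkMain (4 * π) + 2 * kinkCorr (4 * π) := integral_abs_kink_le hcm
  have hRp_eq : ∫ v in Ioi (0:ℝ), Rp v = 0 * (Real.sqrt (3 / 10) / 2) + 1 / (2 * a ^ 2) * (1 / (2 * (10 * π / 3)))
      + (2 + Real.sqrt 2) * Real.sqrt 2 / (3 * a ^ 3) * (Real.sqrt (3 / 10) / (4 * (10 * π / 3)))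
      + 2 * π / a ^ 2 * (1 / (2 * (10 * π / 3) ^ 2))
      + (2 + Real.sqrt 2) * Real.sqrt 2 * (8 * π / 5) / a ^ 3 * (3 * Real.sqrt (3 / 10) / (8 * (10 * π / 3) ^ 2))
      + 0 * (1 / (10 * π / 3) ^ 3) := by
    rw [hRp, hRest hcp, integral_poly_mul_exp _ _ _ _ _ _ hcp, sqrt_ratios.1]
  have hRm_eq : ∫ v in Ioi (0:ℝ), Rm v = 0 * ((1 / 2) / 2) + 1 / (2 * a ^ 2) * (1 / (2 * (4 * π)))
      + (2 + Real.sqrt 2) * Real.sqrt 2 / (3 * a ^ 3) * ((1 / 2) / (4 * (4 * π)))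
      + 2 * π / a ^ 2 * (1 / (2 * (4 * π) ^ 2))
      + (2 + Real.sqrt 2) * Real.sqrt 2 * (8 * π / 5) / a ^ 3 * (3 * (1 / 2) / (8 * (4 * π) ^ 2))
      + 0 * (1 / (4 * π) ^ 3) := by
    rw [hRm, hRest hcm, integral_poly_mul_exp _ _ _ _ _ _ hcm, sqrt_ratios.2]
  have hQm_eq : ∫ v in Ioi (0:ℝ), Qm v = 0 * ((1 / 2) / 2) + Real.sqrt 2 / (2 * a) * (1 / (2 * (4 * π)))
      + 1 / (2 * a ^ 2) * ((1 / 2) / (4 * (4 * π)))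
      + (4 * Real.sqrt 2 * π / (3 * a) + (2 + Real.sqrt 2) * Real.sqrt 2 / (3 * a ^ 3)) * (1 / (2 * (4 * π) ^ 2))
      + 2 * π / a ^ 2 * (3 * (1 / 2) / (8 * (4 * π) ^ 2))
      + (2 + Real.sqrt 2) * Real.sqrt 2 * (8 * π / 5) / a ^ 3 * (1 / (4 * π) ^ 3) := by
    rw [hQm, hQ, integral_poly_mul_exp _ _ _ _ _ _ hcm, sqrt_ratios.2]
  have hFr_eq : ∫ v in Ioi (0:ℝ), Fr v = farFactor a * (Real.exp (Real.log 2 / 4) / 2 + 1 / 4) := integral_far a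
  have hfar := farFactor_le ha
  have hfarpos : 0 ≤ Real.exp (Real.log 2 / 4) / 2 + 1 / 4 := by positivity
  have hc1 : 0 ≤ Real.sqrt 2 / (2 * π * a) := by positivity
  have hK1 := mul_le_mul_of_nonneg_left hKp_le hc1
  have hK2 := mul_le_mul_of_nonneg_left hKm_le hc1
  have hF2 := mul_le_mul_of_nonneg_right hfar hfarpos
  rw [hsplit, kerIntegralBoundSharp]
  rw [hv1, hRp_eq, hFr_eq] at hle1
  rw [hv2, hRm_eq, hQm_eq, hFr_eq] at hle2
  linarith

/-- **Explicit Riemann–Siegel remainder bound, sharp form** (Gabcke 1979, Satz 3.2.2 with weakened constants):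
for `t ≥ 8` with `a = √(t/2π) ∉ ℤ` and `cos πz ≠ 0`,
`|R₀(t)| ≤ (2/√a)(√2 · S♯(a) + (2K(¼)/t)(√2/4)e^{π/4})`, `S♯ = kerIntegralBoundSharp`; numerically
`|R₀(t)| ≤ 0.1203 a^{−3/2} + 0.352 a^{−5/2} + 0.06 a^{−7/2} + 0.01 a^{−9/2} + 60.0 a^{−11/2}`
(`≈ 0.477 t^{−3/4} + 3.5 t^{−5/4} + …`), under which every sample of the tree's certified evaluations for
`RiemannHypothesisUpTo 10⁴ / 10⁵` certifies as planted (engine-1 note GABCKE-K0-ROUTE). [cite: Gabcke1979, §3.2 Satz 3.2.2] -/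
theorem abs_R0_le_sharp {t : ℝ} (ht : 8 ≤ t) (hai : ∀ n : ℤ, (n : ℝ) ≠ Gabcke.a t)
    (hcos : Real.cos (π * Gabcke.z t) ≠ 0) :
    |R0 t| ≤ 2 / Real.sqrt (Gabcke.a t) * (Real.sqrt 2 * kerIntegralBoundSharp (Gabcke.a t)
      + 2 * stirlingVertRate (1 / 4) / t * (Real.sqrt 2 / 4 * Real.exp (π / 4))) := by
  have ht0 : (0:ℝ) < t := by linarith
  have hA : 0 < Gabcke.a t := Real.sqrt_pos.2 (div_pos ht0 (by positivity))
  have h := abs_R0_le (by linarith) (one_le_N ht) hai hcos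
  refine h.trans (mul_le_mul_of_nonneg_left (add_le_add (mul_le_mul_of_nonneg_left
    (integral_norm_rsKer_sub_le_sharp hA hai) (Real.sqrt_nonneg 2)) le_rfl) (by positivity))

end Gabcke

end Literature.NumberTheory.LFunctions
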